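import Literature.NumberTheory.EllipticCurves.TwoIsogenyDescentIndex
import Literature.NumberTheory.EllipticCurves.TwoIsogenySelmerGroupRankProofs
import Literature.NumberTheory.EllipticCurves.BinaryQuarticStabilizerTorsion
import Literature.NumberTheory.EllipticCurves.TwoIsogenySelmerGroupSha
import Literature.NumberTheory.EllipticCurves.TwoIsogenyShaTwoTorsion
import Literature.NumberTheory.EllipticCurves.BSDRankZeroDensityProofs
import Mathlib.NumberTheory.Padics.RingHoms
import Mathlib.NumberTheory.LegendreSymbol.QuadraticReciprocity
import Mathlib.Tactic.NormNum.LegendreSymbol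
import Mathlib.Data.Rat.Lemmas
import HarnessLib

/-!
# Zywina 2025: an explicit infinite family of elliptic curves over `ℚ` of rank exactly `2`
# — Theorem 1.2 (rank part), PROVED by the descent via `2`-isogeny

D. Zywina, *There are infinitely many elliptic curves over the rationals of rank 2*,
arXiv:2502.01957 (2025) [Zywina2025], Theorem 1.2 (§1, p. 1), verbatim:

> **Theorem 1.2.** Let `m` and `n` be any natural numbers for which `m`, `m + 16n²` and `m + 25n²`
> are primes congruent to `11` modulo `24`. Let `E` be the elliptic curve over `ℚ` defined by the
> equation `y² = x³ - 5(m+16n²)x² + 4(m+16n²)(m+25n²)x`. Then `E(ℚ) ≅ ℤ/2ℤ × ℤ²`.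

(Theorem 1.1, "there are infinitely many elliptic curves over `ℚ` of rank `2`", follows because the
polynomial Szemerédi theorem in the primes of Tao–Ziegler gives infinitely many admissible `(m, n)`,
§4 of the paper; that input is NOT formalised here.)

This file PROVES the **rank statement** of Theorem 1.2 for every admissible pair,

* `Zywina2025.mordellWeilRank_zywinaCurve : ZywinaAdmissible m n → (zywinaCurve m n).mordellWeilRank = 2`,

with no named fact, by carrying out Zywina's §3 (descent via the `2`-isogeny with kernel `⟨(0,0)⟩`,
Silverman *AEC* X.4.9 / Silverman–Tate §3.4–3.6) over the tree's machinery: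
`WeierstrassCurve.xSqClass` (the homomorphism `α : E(ℚ) → ℚ*/ℚ*²`, `(x,y) ↦ [x]`, `T ↦ [b]`,
`TwoIsogenyDescentAlpha.lean`), `exists_squarefree_dvd_sqClass_eq` (classes in `α(E(ℚ))` are classes of
squarefree divisors of `b`) and `exists_sq_eq_quartic_iff` (`[d] ∈ α(E(ℚ))` iff the homogeneous space
`w² = d u⁴ + a u²z² + (b/d) z⁴` has a rational point) from `TwoIsogenySelmerGroupRankProofs.lean`, and the
exact count `#α(E(ℚ)) · #α(E'(ℚ)) = 2^{rank + 2}` (`natCard_range_xSqClass_mul`, `TwoIsogenyDescentIndex.lean`,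
which rests on the tree's proved Mordell–Weil theorem).

With `q = m + 16n²`, `r = m + 25n²`, `E = E_{a,b} : y² = x³ + ax² + bx`, `a = -5q`, `b = 4qr`, the
`2`-isogenous curve is `E' = E_{-2a, a²-4b} = E_{10q, 9mq}` (`25q² - 16qr = 9mq`). Zywina's Lemmas 3.1–3.3
compute `Sel_φ(E/ℚ) = {1, -m, -q, mq} = δ(E'(ℚ))` and `Sel_φ̂(E'/ℚ) = {1, q, r, qr} = δ'(E(ℚ))`. Here we prove the
statements about the IMAGES `α(E(ℚ)) = {[1],[q],[r],[qr]}`, `α(E'(ℚ)) = {[1],[-m],[-q],[mq]}` (which is all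
the rank needs), running his local arguments on primitive integral points of the quartics:

* (`exists_primitive_of_sq_eq_quartic`) a rational point of `w² = d u⁴ + a u²z² + d' z⁴` gives a primitive
  integral one;
* (`not_sq_eq_quartic_of_neg`) `d, d' < 0`, `a ≤ 0`: no point (the real condition of Lemma 3.2);
* (`isSquare_zmod_of_sq_eq_quartic`) at an odd prime `p ∤ d` with `p ∥ a² - 4dd'`, a primitive point forces
  `d` to be a non-zero square mod `p` (the `ℚ_p`-argument of Lemmas 3.1/3.2, used at `p = m` for `E` — where
  `(2/m) = -1`, `(q/m) = (r/m) = 1` — and at `p = r` for `E'` — where `(-1/r) = -1`, `(3/r) = 1`,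
  `(m/r) = (q/r) = -1`);
* (`not_sq_eq_quartic_two_adic`) `d ≡ d' ≡ c ≡ 3 (mod 4)`, `c² ≡ dd' (mod 16)`: `w² = d u⁴ + 2c u²z² + d' z⁴`
  has no primitive point (the `ℚ₂`-argument of Lemma 3.1, for `E'` with `c = 5q`, `c² - dd' = 16qr`).

The lower bounds are the explicit points `T = (0,0)`, `P₁ = (q, 6nq)` on `E` and `T' = (0,0)`,
`Q₁ = (-q, 12nq)` on `E'` (Lemma 3.3) and the multiplicativity of `α`; so `4 · 4 = 2^{rank+2}`, `rank = 2`.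

Admissibility here includes `0 < n` ("natural numbers" in the paper; for `n = 0` the three primes coincide
and the curve `y² = x(x-m)(x-4m)` is not in the family).

Appendix C runs the same local arguments over `ℚ_p` (`ℤ_p`-charts of the quartic, reduction via
`PadicInt.toZMod` / `toZModPow 4`) and computes the SELMER GROUPS of the two isogenies as the tree's
finite sets: `S(-5q, 4qr) = {1, q, r, qr}` and `S(10q, 9mq) = {1, -m, -q, mq}` (Lemmas 3.1–3.3 in full),
hence, by the tree's count `2^{dim S} = #α · #(Ш ∩ im Ξ)` (`TwoIsogenySelmerGroupSha`), the `φ`-parts of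
`Ш` vanish: `Ш(E/ℚ) ∩ im Ξ = ⊥` for `E = E_{m,n}` and for the model `V₀` of `E'`.

Deliberately NOT here (each is a further printed statement of the paper, not needed for the rank):
the torsion subgroup `E(ℚ)_tors = ℤ/2` (Lemma 3.4, via Tate's algorithm at `2`), the passage from the
two isogeny-Selmer groups to `Sel₂(E/ℚ) ≅ (ℤ/2)³` and `Ш(E/ℚ)[2] = 0` (the tree has no
`Sel^φ → Sel₂ → Sel^φ̂` sequence), the root number `W(E) = +1` (§1.1, stated there without proof), and
the infinitude of admissible pairs (§4, Tao–Ziegler). Written for cell `bsd-rank2` (D-0036), whose planner sketch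
(`run/shared/lean/pub/bsd-rank2/p3/ZywinaFamilySketch.lean`) takes "rank `= 2`" as a hypothesis
`zywina2025_descent` — now a theorem for the rank conjunct.

## References

* [Zywina2025] D. Zywina, *There are infinitely many elliptic curves over the rationals of rank 2*,
  arXiv:2502.01957 (2025): Thm 1.2, §2 (descent via two-isogeny), §3 Lemmas 3.1–3.3.
* [SilvermanTate2015] J. H. Silverman, J. T. Tate, *Rational Points on Elliptic Curves*, 2nd ed.,
  §3.4–§3.6 (`α`, `2^r = #α(Γ)·#ᾱ(Γ̄)/4`).
* [SilvermanAEC2009] J. H. Silverman, *The Arithmetic of Elliptic Curves*, 2nd ed., Prop. X.4.9.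

## Design

`open scoped Classical` and literal curves `⟨0, (a : ℚ), 0, (b : ℚ), 0⟩` with `a b : ℤ` casts, exactly as in
the `TwoIsogeny*` files whose statements are instantiated. The admissibility data is unpacked once into the
`Prop`-valued structure `ZywinaParams m n q r` (`q = m + 16n²`, `r = m + 25n²`), over which all lemmas are
stated; the user-facing statements are about `zywinaCurve m n` under `ZywinaAdmissible m n`.
-/

noncomputable section

namespace Literature.NumberTheory.EllipticCurves.Zywina2025

open scoped Classical

open _root_.WeierstrassCurve
open _root_.WeierstrassCurve.Affine (SqUnits sqClass sqClass_mul sqClass_sq sqClass_eq_one_iff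
  sqClass_eq_mul_of_mul_mul_eq_sq)
open Literature.NumberTheory.EllipticCurves

/-! ### Rational points of `w² = d u⁴ + a u²z² + d' z⁴` give primitive integral ones -/

/-- A rational point `(u : z : w)`, `(u, z) ≠ (0, 0)`, of the quartic `w² = d u⁴ + a u²z² + d' z⁴`
with integer coefficients gives a PRIMITIVE integral one (`gcd(U, Z) = 1`): for `z = 0` the
coefficient `d` is a rational, hence integral, square and `(U, Z) = (1, 0)` works; for `z ≠ 0`
write `u/z = U/Z` in lowest terms, then `d U⁴ + a U²Z² + d' Z⁴ = (w Z²/z²)²` is an integer that is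
a rational square, hence an integral square (Silverman–Tate §3.6: "write `x = b₁M²/e²` in lowest terms").
[cite: SilvermanTate2015, §3.6] -/
theorem exists_primitive_of_sq_eq_quartic {d a d' : ℤ} {u z w : ℚ} (h0 : u ≠ 0 ∨ z ≠ 0)
    (h : w ^ 2 = d * u ^ 4 + a * u ^ 2 * z ^ 2 + d' * z ^ 4) :
    ∃ U Z W : ℤ, Int.gcd U Z = 1 ∧ W ^ 2 = d * U ^ 4 + a * U ^ 2 * Z ^ 2 + d' * Z ^ 4 := by
  by_cases hz : z = 0
  · have hu : u ≠ 0 := h0.resolve_right (fun h' => h' hz)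
    subst hz
    have h' : w ^ 2 = d * u ^ 4 := by rw [h]; ring
    have hu4 : u ^ 4 ≠ 0 := pow_ne_zero 4 hu
    have hsq : IsSquare ((d : ℤ) : ℚ) := by
      refine ⟨w / u ^ 2, ?_⟩
      field_simp
      linear_combination -h'
    obtain ⟨W, hW⟩ := Rat.isSquare_intCast_iff.mp hsq
    exact ⟨1, 0, W, by simp, by rw [hW]; ring⟩
  · obtain ⟨x, hx⟩ : ∃ x : ℚ, x = u / z := ⟨_, rfl⟩
    have hgcd : Int.gcd x.num x.den = 1 := by
      change x.num.natAbs.gcd (x.den : ℤ).natAbs = 1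
      rw [Int.natAbs_natCast]
      exact x.reduced
    -- the integer `N = d U⁴ + a U²Z² + d' Z⁴` is the rational square `(w Z²/z²)²`
    have hxz : u = x * z := by rw [hx]; field_simp
    have hN : (x.num : ℚ) = x * x.den := (Rat.mul_den_eq_num x).symm
    have hz4 : z ^ 4 ≠ 0 := pow_ne_zero 4 hz
    have key : w ^ 2 = z ^ 4 * (d * x ^ 4 + a * x ^ 2 + d') := by rw [h, hxz]; ring
    have key2 : (d : ℚ) * x.num ^ 4 + a * x.num ^ 2 * x.den ^ 2 + d' * x.den ^ 4 =
        (x.den : ℚ) ^ 4 * (d * x ^ 4 + a * x ^ 2 + d') := by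
      rw [hN]; ring
    have hsq : IsSquare (((d * x.num ^ 4 + a * x.num ^ 2 * x.den ^ 2 + d' * x.den ^ 4 : ℤ)) : ℚ) := by
      refine ⟨w * (x.den : ℚ) ^ 2 / z ^ 2, ?_⟩
      push_cast
      rw [key2]
      calc (x.den : ℚ) ^ 4 * (d * x ^ 4 + a * x ^ 2 + d')
          = (x.den : ℚ) ^ 4 * (w ^ 2 / z ^ 4) := by rw [key]; field_simp
        _ = w * (x.den : ℚ) ^ 2 / z ^ 2 * (w * (x.den : ℚ) ^ 2 / z ^ 2) := by ring
    obtain ⟨W, hW⟩ := Rat.isSquare_intCast_iff.mp hsq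
    exact ⟨x.num, x.den, W, hgcd, by rw [pow_two, ← hW]⟩

/-! ### No real points: `d, d' < 0`, `a ≤ 0` -/

/-- If `d < 0`, `d' < 0` and `a ≤ 0` then `w² = d u⁴ + a u²z² + d' z⁴` has no point with
`(u, z) ≠ (0, 0)` (the right side is negative) — the real-place step of Zywina's Lemma 3.2.
[cite: Zywina2025, Lemma 3.2 (proof)] -/
theorem not_sq_eq_quartic_of_neg {d a d' U Z W : ℤ} (hd : d < 0) (hd' : d' < 0) (ha : a ≤ 0)
    (h0 : U ≠ 0 ∨ Z ≠ 0) (h : W ^ 2 = d * U ^ 4 + a * U ^ 2 * Z ^ 2 + d' * Z ^ 4) : False := by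
  have hU4 : 0 ≤ U ^ 4 := by positivity
  have hZ4 : 0 ≤ Z ^ 4 := by positivity
  have hUZ : 0 ≤ U ^ 2 * Z ^ 2 := by positivity
  have hW : 0 ≤ W ^ 2 := by positivity
  rcases h0 with hU | hZ
  · have hU4' : 0 < U ^ 4 := Even.pow_pos (by decide) hU
    nlinarith
  · have hZ4' : 0 < Z ^ 4 := Even.pow_pos (by decide) hZ
    nlinarith

/-! ### The local condition at an odd prime dividing `a² - 4dd'` exactly once -/

/-- **`d` is a non-zero square modulo `p`.** Let `p` be an odd prime with `p ∤ d` and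
`p ∥ a² - 4 d d'` (i.e. `p ∣ a² - 4dd'`, `p² ∤ a² - 4dd'`). If `w² = d u⁴ + a u²z² + d' z⁴` has a
primitive integral solution (`gcd(u, z) = 1`), then `d` is a non-zero square modulo `p`.
Proof (Zywina 2025, proof of Lemmas 3.1 and 3.2, integrally): complete the square,
`4d w² = s² - (a² - 4dd') z⁴` with `s = 2d u² + a z²`. If `p ∣ s`: when `p ∣ z` also `p ∣ 2d u²`,
so `p ∣ u`, contradicting primitivity; when `p ∤ z`, `p ∣ 4dw²` forces `p ∣ w`, so
`p² ∣ (a² - 4dd') z⁴` and `p² ∣ a² - 4dd'`, contradiction. Hence `p ∤ s` and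
`4 d w² ≡ s² (mod p)` with `s ≢ 0` exhibits `d` as a non-zero square.
[cite: Zywina2025, Lemma 3.1 (proof)] -/
theorem isSquare_zmod_of_sq_eq_quartic {p : ℕ} [hp : Fact p.Prime] (hp2 : p ≠ 2)
    {d a d' U Z W : ℤ} (hpd : ¬ (p : ℤ) ∣ d) (hpB : (p : ℤ) ∣ a ^ 2 - 4 * d * d')
    (hpB2 : ¬ (p : ℤ) ^ 2 ∣ a ^ 2 - 4 * d * d') (hcop : Int.gcd U Z = 1)
    (h : W ^ 2 = d * U ^ 4 + a * U ^ 2 * Z ^ 2 + d' * Z ^ 4) :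
    (d : ZMod p) ≠ 0 ∧ IsSquare (d : ZMod p) := by
  have hpp : Prime (p : ℤ) := Nat.prime_iff_prime_int.mp hp.out
  set S : ℤ := 2 * d * U ^ 2 + a * Z ^ 2 with hS
  set B : ℤ := a ^ 2 - 4 * d * d' with hB
  have key : 4 * d * W ^ 2 = S ^ 2 - B * Z ^ 4 := by rw [h, hS, hB]; ring
  have hp2' : ¬ (p : ℤ) ∣ 2 := fun h2 => by
    have : (p : ℤ) ≤ 2 := Int.le_of_dvd (by norm_num) h2
    have := hp.out.two_le
    omega
  have hd0 : (d : ZMod p) ≠ 0 := by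
    rwa [Ne, ZMod.intCast_zmod_eq_zero_iff_dvd]
  refine ⟨hd0, ?_⟩
  by_cases hpS : (p : ℤ) ∣ S
  · exfalso
    by_cases hpZ : (p : ℤ) ∣ Z
    · -- `p ∣ 2 d U²`, so `p ∣ U`, contradicting `gcd(U, Z) = 1`
      have h1 : (p : ℤ) ∣ 2 * d * U ^ 2 := by
        have : (p : ℤ) ∣ S - a * Z ^ 2 := dvd_sub hpS (dvd_mul_of_dvd_right (dvd_pow hpZ two_ne_zero) _)
        simpa [hS] using this
      have hpU : (p : ℤ) ∣ U := by
        rcases hpp.dvd_or_dvd h1 with h2 | h2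
        · rcases hpp.dvd_or_dvd h2 with h3 | h3
          · exact absurd h3 hp2'
          · exact absurd h3 hpd
        · exact hpp.dvd_of_dvd_pow h2
      have hg : p ∣ Int.gcd U Z := Int.dvd_gcd hpU hpZ
      rw [hcop] at hg
      exact hp.out.ne_one (Nat.dvd_one.mp hg)
    · -- `p ∤ Z`: `p ∣ w`, then `p² ∣ B Z⁴`, `p² ∣ B`
      have h1 : (p : ℤ) ∣ 4 * d * W ^ 2 := by
        rw [key]
        exact dvd_sub (dvd_pow hpS two_ne_zero) (dvd_mul_of_dvd_left hpB _)
      have hpW : (p : ℤ) ∣ W := by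
        rcases hpp.dvd_or_dvd h1 with h2 | h2
        · rcases hpp.dvd_or_dvd h2 with h3 | h3
          · exact absurd (hpp.dvd_of_dvd_pow (show (p : ℤ) ∣ 2 ^ 2 by simpa using h3)) hp2'
          · exact absurd h3 hpd
        · exact hpp.dvd_of_dvd_pow h2
      have h2 : (p : ℤ) ^ 2 ∣ B * Z ^ 4 := by
        have e : B * Z ^ 4 = S ^ 2 - 4 * d * W ^ 2 := by rw [key]; ring
        rw [e]
        exact dvd_sub (pow_dvd_pow_of_dvd hpS 2)
          (Dvd.dvd.mul_left (pow_dvd_pow_of_dvd hpW 2) (4 * d))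
      obtain ⟨B₁, hB₁⟩ := hpB
      rw [hB₁, mul_assoc, pow_two] at h2
      have h3 : (p : ℤ) ∣ B₁ * Z ^ 4 := (mul_dvd_mul_iff_left hpp.ne_zero).mp h2
      rcases hpp.dvd_or_dvd h3 with h4 | h4
      · apply hpB2
        rw [hB₁, pow_two]
        exact mul_dvd_mul_left _ h4
      · exact hpZ (hpp.dvd_of_dvd_pow h4)
  · -- `p ∤ s`: `4 d w² = s²` in `𝔽_p` with `s ≠ 0`
    have hS0 : (S : ZMod p) ≠ 0 := by rwa [Ne, ZMod.intCast_zmod_eq_zero_iff_dvd]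
    have hB0 : (B : ZMod p) = 0 := by rwa [ZMod.intCast_zmod_eq_zero_iff_dvd]
    have key' : (4 : ZMod p) * d * W ^ 2 = (S : ZMod p) ^ 2 := by
      have := congrArg (Int.cast : ℤ → ZMod p) key
      push_cast at this
      rw [this, hB0, zero_mul, sub_zero]
    have h20 : (2 : ZMod p) ≠ 0 := by
      have : ((2 : ℤ) : ZMod p) ≠ 0 := by rwa [Ne, ZMod.intCast_zmod_eq_zero_iff_dvd]
      simpa using this
    have hW0 : (W : ZMod p) ≠ 0 := by
      intro hW
      rw [hW, zero_pow two_ne_zero, mul_zero] at key'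
      exact hS0 (pow_eq_zero_iff two_ne_zero |>.mp key'.symm)
    refine ⟨(S : ZMod p) / (2 * W), ?_⟩
    field_simp
    linear_combination key'

/-! ### The local condition at `2` -/

/-- Odd squares are `1 mod 8`. [folklore] -/
private theorem sq_emod_eight_of_odd {x : ℤ} (hx : Odd x) : x ^ 2 % 8 = 1 := by
  obtain ⟨k, rfl⟩ := hx
  have : (2 * k + 1) ^ 2 = 4 * (k * (k + 1)) + 1 := by ring
  rw [this]
  have hk : 2 ∣ k * (k + 1) := Int.even_mul_succ_self k |>.two_dvd
  obtain ⟨j, hj⟩ := hk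
  rw [hj]
  omega

/-- Squares are `0, 1, 4` or `9 mod 16`. [folklore] -/
private theorem sq_emod_sixteen (x : ℤ) : x ^ 2 % 16 = 0 ∨ x ^ 2 % 16 = 1 ∨ x ^ 2 % 16 = 4 ∨ x ^ 2 % 16 = 9 := by
  have h16 : x ^ 2 % 16 = ((x % 16) * (x % 16)) % 16 := by rw [pow_two, Int.mul_emod]
  have hlo : 0 ≤ x % 16 := Int.emod_nonneg _ (by norm_num)
  have hhi : x % 16 < 16 := Int.emod_lt_of_pos _ (by norm_num)
  rw [h16]
  generalize x % 16 = r at hlo hhi ⊢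
  interval_cases r <;> omega

/-- **The local condition at `2`** (Zywina 2025, proof of Lemma 3.1, integrally). Let
`d ≡ d' ≡ c ≡ 3 (mod 4)` with `c² - d d' ≡ 0 (mod 16)`. Then `w² = d u⁴ + 2c u²z² + d' z⁴` has
no primitive integral solution: if exactly one of `u, z` is even the right side is `≡ 3 (mod 4)`;
if both are odd then `u⁴ ≡ z⁴ ≡ 1 (mod 16)` and `2c u²z² ≡ 2c (mod 16)`, so
`w² ≡ d + d' + 2c ≡ 12 (mod 16)` (using `dd' ≡ c² (mod 16)`), which is not a square.
[cite: Zywina2025, Lemma 3.1 (proof)] -/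
theorem not_sq_eq_quartic_two_adic {d d' c e U Z W : ℤ} (hd : d % 4 = 3) (hd' : d' % 4 = 3)
    (hc : c % 4 = 3) (he : c ^ 2 - d * d' = 16 * e) (hcop : Int.gcd U Z = 1)
    (h : W ^ 2 = d * U ^ 4 + 2 * c * U ^ 2 * Z ^ 2 + d' * Z ^ 4) : False := by
  have hW := sq_emod_sixteen W
  rcases Int.even_or_odd U with hU | hU <;> rcases Int.even_or_odd Z with hZ | hZ
  · -- both even: not primitive
    have h2 : 2 ∣ Int.gcd U Z := Int.dvd_gcd (by exact_mod_cast hU.two_dvd) (by exact_mod_cast hZ.two_dvd)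
    rw [hcop] at h2
    norm_num at h2
  · -- `U` even, `Z` odd: `W² ≡ d' ≡ 3 (mod 4)`
    obtain ⟨u, rfl⟩ := hU
    have hZ2 := sq_emod_eight_of_odd hZ
    have e1 : W ^ 2 = 4 * (4 * d * u ^ 4 + 2 * c * u ^ 2 * Z ^ 2) + d' * (Z ^ 2) ^ 2 := by
      rw [h]; ring
    have hP : d' * (Z ^ 2) ^ 2 % 4 = 3 := by
      rw [Int.mul_emod, pow_two, Int.mul_emod (Z ^ 2)]
      have : Z ^ 2 % 4 = 1 := by omega
      rw [this, hd']; norm_num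
    generalize d' * (Z ^ 2) ^ 2 = P at e1 hP
    generalize 4 * d * u ^ 4 + 2 * c * u ^ 2 * Z ^ 2 = A at e1
    generalize W ^ 2 = w2 at hW e1
    omega
  · -- `U` odd, `Z` even: `W² ≡ d ≡ 3 (mod 4)`
    obtain ⟨z, rfl⟩ := hZ
    have hU2 := sq_emod_eight_of_odd hU
    have e1 : W ^ 2 = 4 * (4 * d' * z ^ 4 + 2 * c * U ^ 2 * z ^ 2) + d * (U ^ 2) ^ 2 := by
      rw [h]; ring
    have hP : d * (U ^ 2) ^ 2 % 4 = 3 := by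
      rw [Int.mul_emod, pow_two, Int.mul_emod (U ^ 2)]
      have : U ^ 2 % 4 = 1 := by omega
      rw [this, hd]; norm_num
    generalize d * (U ^ 2) ^ 2 = P at e1 hP
    generalize 4 * d' * z ^ 4 + 2 * c * U ^ 2 * z ^ 2 = A at e1
    generalize W ^ 2 = w2 at hW e1
    omega
  · -- both odd: `W² ≡ d + 2c + d' ≡ 12 (mod 16)`
    have hU2 := sq_emod_eight_of_odd hU
    have hZ2 := sq_emod_eight_of_odd hZ
    obtain ⟨i, hi⟩ : ∃ i, U ^ 2 = 8 * i + 1 := ⟨U ^ 2 / 8, by omega⟩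
    obtain ⟨j, hj⟩ : ∃ j, Z ^ 2 = 8 * j + 1 := ⟨Z ^ 2 / 8, by omega⟩
    obtain ⟨δ, hδ⟩ : ∃ δ, d = 4 * δ + 3 := ⟨d / 4, by omega⟩
    obtain ⟨δ', hδ'⟩ : ∃ δ', d' = 4 * δ' + 3 := ⟨d' / 4, by omega⟩
    obtain ⟨γ, hγ⟩ : ∃ γ, c = 4 * γ + 3 := ⟨c / 4, by omega⟩
    have e1 : W ^ 2 = 16 * (d * (4 * i ^ 2 + i) + c * (8 * i * j + i + j) + d' * (4 * j ^ 2 + j)) +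
        (d + 2 * c + d') := by
      linear_combination h + d * (U ^ 2 + 8 * i + 1) * hi + 2 * c * Z ^ 2 * hi +
        2 * c * (8 * i + 1) * hj + d' * (Z ^ 2 + 8 * j + 1) * hj
    subst hδ hδ' hγ
    have e2 : 12 * (δ + δ') = 24 * γ + 16 * (γ ^ 2 - δ * δ' - e) := by linear_combination (-1 : ℤ) * he
    generalize (4 * δ + 3) * (4 * i ^ 2 + i) + (4 * γ + 3) * (8 * i * j + i + j) +
      (4 * δ' + 3) * (4 * j ^ 2 + j) = K at e1
    generalize γ ^ 2 - δ * δ' - e = M at e2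
    generalize W ^ 2 = w2 at hW e1
    omega

/-! ### Divisors of `p k`, of a prime, of a product of two primes -/

/-- Divisors of `p · k` for a prime `p`: either `d ∣ k`, or `d = p d₁` with `d₁ ∣ k`. [folklore] -/
private theorem dvd_prime_mul {p : ℕ} (hp : p.Prime) {d k : ℤ} (h : d ∣ (p : ℤ) * k) :
    d ∣ k ∨ ∃ d₁, d = p * d₁ ∧ d₁ ∣ k := by
  by_cases hpd : (p : ℤ) ∣ d
  · obtain ⟨d₁, rfl⟩ := hpd
    refine Or.inr ⟨d₁, rfl, ?_⟩
    exact (mul_dvd_mul_iff_left (by exact_mod_cast hp.ne_zero)).mp h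
  · left
    have hg : Int.gcd d p = 1 := by
      rw [Int.gcd_comm]
      change (p : ℤ).natAbs.gcd d.natAbs = 1
      rw [Int.natAbs_natCast]
      exact (Nat.Prime.coprime_iff_not_dvd hp).mpr (fun h' => hpd (Int.natCast_dvd.mpr h'))
    exact Int.dvd_of_dvd_mul_right_of_gcd_one h hg

/-- Divisors of a prime `p` in `ℤ`: `±1, ±p`. [folklore] -/
private theorem eq_of_dvd_prime {p : ℕ} (hp : p.Prime) {d : ℤ} (h : d ∣ (p : ℤ)) :
    d = 1 ∨ d = -1 ∨ d = p ∨ d = -p := by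
  have h' : d.natAbs ∣ p := by
    have := Int.natAbs_dvd_natAbs.mpr h
    simpa using this
  rcases (Nat.dvd_prime hp).mp h' with h1 | h1 <;>
    rcases Int.natAbs_eq d with h2 | h2 <;> rw [h1] at h2 <;> simp [h2]

/-- Divisors of `q r` for primes `q, r`: `±1, ±q, ±r, ±qr`. [folklore] -/
private theorem eq_of_dvd_prime_mul_prime {q r : ℕ} (hq : q.Prime) (hr : r.Prime) {d : ℤ}
    (h : d ∣ (q : ℤ) * r) :
    d = 1 ∨ d = -1 ∨ d = q ∨ d = -q ∨ d = r ∨ d = -r ∨ d = q * r ∨ d = -(q * r) := by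
  rcases dvd_prime_mul hq h with h1 | ⟨d₁, rfl, h1⟩
  · rcases eq_of_dvd_prime hr h1 with h2 | h2 | h2 | h2 <;> simp [h2]
  · rcases eq_of_dvd_prime hr h1 with h2 | h2 | h2 | h2 <;> simp [h2]

/-! ### Legendre symbols: dependence on the residue class -/

/-- `(a/p) = (b/p)` when `a ≡ b (mod p)`. [folklore] -/
private theorem legendreSym_congr {p : ℕ} [Fact p.Prime] {a b : ℤ} (h : (a : ZMod p) = (b : ZMod p)) :
    legendreSym p a = legendreSym p b := by
  simp only [legendreSym, h]

/-- `(1/p) = 1`. [folklore] -/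
private theorem legendreSym_one' {p : ℕ} [Fact p.Prime] : legendreSym p 1 = 1 := by
  have := legendreSym.sq_one' (p := p) (a := 1) (by simp)
  simpa only [one_pow] using this

/-- `(-1/p) = -1` for `p ≡ 3 (mod 4)`. [folklore] -/
private theorem legendreSym_neg_one_of_mod_four {p : ℕ} [Fact p.Prime] (hp : p % 4 = 3) :
    legendreSym p (-1) = -1 := by
  rw [legendreSym.eq_neg_one_iff]
  push_cast
  rw [ZMod.exists_sq_eq_neg_one_iff]
  exact fun h => h hp

/-- `(2/p) = -1` for `p ≡ 3 (mod 8)`. [folklore] -/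
private theorem legendreSym_two_of_mod_eight {p : ℕ} [Fact p.Prime] (hp : p % 8 = 3) :
    legendreSym p 2 = -1 := by
  have hp2 : p ≠ 2 := by rintro rfl; norm_num at hp
  rw [legendreSym.eq_neg_one_iff]
  push_cast
  rw [ZMod.exists_sq_eq_two_iff hp2]
  omega

/-- `(3/p) = 1` for a prime `p ≡ 11 (mod 12)` (quadratic reciprocity: `(3/p) = -(p/3) = -(2/3) = 1`).
[folklore] -/
private theorem legendreSym_three_of_mod_twelve {p : ℕ} [Fact p.Prime] (hp4 : p % 4 = 3) (hp3 : p % 3 = 2) :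
    legendreSym p 3 = 1 := by
  haveI : Fact (Nat.Prime 3) := ⟨Nat.prime_three⟩
  have h := legendreSym.quadratic_reciprocity_three_mod_four (p := 3) (q := p) (by norm_num) hp4
  push_cast at h
  rw [h, legendreSym.mod 3 (p : ℤ)]
  have : (p : ℤ) % ((3 : ℕ) : ℤ) = 2 := by exact_mod_cast hp3
  rw [this]
  have h32 : legendreSym 3 2 = -1 := by
    rw [legendreSym.eq_neg_one_iff]
    push_cast
    rw [ZMod.exists_sq_eq_two_iff (by norm_num)]
    norm_num
  rw [h32]; norm_num

/-- `(t²/p) = 1` and `(-t²/p) = -1` for `p ∤ t`, `p ≡ 3 (mod 4)`. [folklore] -/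
private theorem legendreSym_neg_sq {p : ℕ} [Fact p.Prime] (hp : p % 4 = 3) {t : ℤ} (ht : (t : ZMod p) ≠ 0) :
    legendreSym p (-t ^ 2) = -1 := by
  rw [show -t ^ 2 = (-1) * t ^ 2 by ring, legendreSym.mul, legendreSym.sq_one' p ht,
    legendreSym_neg_one_of_mod_four hp]; norm_num


/-! ### Squarefree divisors; square classes of squarefree integers -/

/-- A squarefree divisor of `p² k` (`p` prime) divides `p k`. [folklore] -/
private theorem dvd_of_squarefree_of_dvd_prime_sq_mul {p : ℕ} (hp : p.Prime) {d k : ℤ} (hd : Squarefree d)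
    (h : d ∣ (p : ℤ) * ((p : ℤ) * k)) : d ∣ (p : ℤ) * k := by
  rcases dvd_prime_mul hp h with h1 | ⟨d₁, rfl, h1⟩
  · exact h1
  · rcases dvd_prime_mul hp h1 with h2 | ⟨d₂, rfl, _⟩
    · exact mul_dvd_mul_left _ h2
    · exfalso
      have hu : IsUnit (p : ℤ) := hd p ⟨d₂, by ring⟩
      rw [Int.isUnit_iff] at hu
      have := hp.two_le
      omega

/-- Squarefree integers with the same square class in `ℚ*/ℚ*²` are equal. [folklore] -/
private theorem eq_of_sqClass_intCast_eq {d₁ d₂ : ℤ} (h₁ : Squarefree d₁) (h₂ : Squarefree d₂)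
    (he : sqClass (d₁ : ℚ) = sqClass (d₂ : ℚ)) : d₁ = d₂ := by
  have h0₁ : (d₁ : ℚ) ≠ 0 := by exact_mod_cast h₁.ne_zero
  have h0₂ : (d₂ : ℚ) ≠ 0 := by exact_mod_cast h₂.ne_zero
  have h1 : sqClass ((d₁ : ℚ) * d₂) = 1 := by rw [sqClass_mul h0₁ h0₂, he, SqUnits.mul_self]
  obtain ⟨u, hu⟩ := (sqClass_eq_one_iff (mul_ne_zero h0₁ h0₂)).mp h1
  obtain ⟨m, hm⟩ : IsSquare (d₁ * d₂) := by
    rw [← Rat.isSquare_intCast_iff]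
    exact ⟨u, by push_cast; rw [hu, pow_two]⟩
  exact eq_of_squarefree_of_mul_eq_sq h₁ h₂ (m := m) (by rw [hm, pow_two])

/-- `[1] = 1` in `ℚ*/ℚ*²`. [folklore] -/
private theorem sqClass_one : sqClass (1 : ℚ) = 1 := (sqClass_eq_one_iff one_ne_zero).mpr ⟨1, by norm_num⟩

/-- A natural prime is squarefree in `ℤ`. [folklore] -/
private theorem squarefree_intCast_of_prime {p : ℕ} (hp : p.Prime) : Squarefree (p : ℤ) :=
  (Nat.prime_iff_prime_int.mp hp).squarefree

/-- The negative of a natural prime is squarefree in `ℤ`. [folklore] -/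
private theorem squarefree_neg_intCast_of_prime {p : ℕ} (hp : p.Prime) : Squarefree (-(p : ℤ)) :=
  Int.squarefree_natAbs.mp (by simpa using hp.squarefree)

/-- The product of two distinct natural primes is squarefree in `ℤ`. [folklore] -/
private theorem squarefree_intCast_mul_of_prime {p q : ℕ} (hp : p.Prime) (hq : q.Prime) (hpq : p ≠ q) :
    Squarefree ((p : ℤ) * q) := by
  refine Int.squarefree_natAbs.mp ?_
  rw [Int.natAbs_mul, Int.natAbs_natCast, Int.natAbs_natCast,
    Nat.squarefree_mul ((Nat.coprime_primes hp hq).mpr hpq)]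
  exact ⟨hp.squarefree, hq.squarefree⟩

/-! ### The parameters -/

/-- Zywina's admissibility data unpacked: `q = m + 16n²`, `r = m + 25n²`, `m, q, r` primes
`≡ 11 (mod 24)`, `n > 0`. [cite: Zywina2025, Thm 1.2] -/
structure ZywinaParams (m n q r : ℕ) : Prop where
  n_pos : 0 < n
  m_prime : m.Prime
  q_prime : q.Prime
  r_prime : r.Prime
  q_eq : q = m + 16 * n ^ 2
  r_eq : r = m + 25 * n ^ 2
  m_mod : m % 24 = 11
  q_mod : q % 24 = 11
  r_mod : r % 24 = 11

namespace ZywinaParams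

variable {m n q r : ℕ} (P : ZywinaParams m n q r)
include P

/-- `q = m + 16n²` in `ℤ`. [cite: Zywina2025, Thm 1.2] -/
theorem q_eq_int : (q : ℤ) = m + 16 * (n : ℤ) ^ 2 := by have := P.q_eq; push_cast [this]; ring
/-- `r = m + 25n²` in `ℤ`. [cite: Zywina2025, Thm 1.2] -/
theorem r_eq_int : (r : ℤ) = m + 25 * (n : ℤ) ^ 2 := by have := P.r_eq; push_cast [this]; ring
/-- `11 ≤ m`. [folklore] -/
private theorem eleven_le : 11 ≤ m := by have := P.m_mod; omega
/-- `m < q`. [folklore] -/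
private theorem m_lt_q : m < q := by have := P.q_eq; have := P.n_pos; nlinarith
/-- `q < r`. [folklore] -/
private theorem q_lt_r : q < r := by have := P.q_eq; have := P.r_eq; have := P.n_pos; nlinarith
/-- `n < r`. [folklore] -/
private theorem n_lt_r : n < r := by have := P.r_eq; have := P.n_pos; nlinarith
/-- `m ≠ q`. [folklore] -/
private theorem m_ne_q : m ≠ q := P.m_lt_q.ne
/-- `m ≠ r`. [folklore] -/
private theorem m_ne_r : m ≠ r := (P.m_lt_q.trans P.q_lt_r).ne
/-- `q ≠ r`. [folklore] -/
private theorem q_ne_r : q ≠ r := P.q_lt_r.ne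

/-- `m ∤ n` (else `m ∣ q = m + 16n²`, so `m = q`). [folklore] -/
private theorem not_m_dvd_n : ¬ m ∣ n := by
  intro h
  have hmq : m ∣ q := by
    rw [P.q_eq]
    exact dvd_add dvd_rfl (dvd_mul_of_dvd_right (dvd_pow h two_ne_zero) _)
  exact P.m_ne_q ((Nat.prime_dvd_prime_iff_eq P.m_prime P.q_prime).mp hmq)

/-- `r ∤ n` (as `0 < n < r`). [folklore] -/
private theorem not_r_dvd_n : ¬ r ∣ n := fun h => absurd (Nat.le_of_dvd P.n_pos h) (not_le.mpr P.n_lt_r)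

/-- `m ∤ k` for `0 < k < 11`. [folklore] -/
private theorem not_m_dvd_small {k : ℕ} (hk0 : 0 < k) (hk : k < 11) : ¬ m ∣ k := fun h =>
  absurd (Nat.le_of_dvd hk0 h) (by have := P.eleven_le; omega)

/-- `r ∤ k` for `0 < k < 11`. [folklore] -/
private theorem not_r_dvd_small {k : ℕ} (hk0 : 0 < k) (hk : k < 11) : ¬ r ∣ k := fun h =>
  absurd (Nat.le_of_dvd hk0 h) (by have := P.eleven_le; have := P.m_lt_q; have := P.q_lt_r; omega)

/-- `k·n ≢ 0 (mod m)` for `0 < k < 11`. [folklore] -/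
private theorem cast_mul_n_ne_zero_m {k : ℕ} (hk0 : 0 < k) (hk : k < 11) : ((k * n : ℤ) : ZMod m) ≠ 0 := by
  rw [Ne, ZMod.intCast_zmod_eq_zero_iff_dvd]
  have hpp : Prime (m : ℤ) := Nat.prime_iff_prime_int.mp P.m_prime
  intro h
  rcases hpp.dvd_or_dvd h with h1 | h1
  · exact P.not_m_dvd_small hk0 hk (Int.natCast_dvd_natCast.mp h1)
  · exact P.not_m_dvd_n (Int.natCast_dvd_natCast.mp h1)

/-- `k·n ≢ 0 (mod r)` for `0 < k < 11`. [folklore] -/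
private theorem cast_mul_n_ne_zero_r {k : ℕ} (hk0 : 0 < k) (hk : k < 11) : ((k * n : ℤ) : ZMod r) ≠ 0 := by
  rw [Ne, ZMod.intCast_zmod_eq_zero_iff_dvd]
  have hpp : Prime (r : ℤ) := Nat.prime_iff_prime_int.mp P.r_prime
  intro h
  rcases hpp.dvd_or_dvd h with h1 | h1
  · exact P.not_r_dvd_small hk0 hk (Int.natCast_dvd_natCast.mp h1)
  · exact P.not_r_dvd_n (Int.natCast_dvd_natCast.mp h1)

/-! Legendre symbols at `m`: `(2/m) = -1`, `(q/m) = (r/m) = 1`. -/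

/-- `(2/m) = -1` (`m ≡ 3 (mod 8)`). [cite: Zywina2025, Lemma 3.2 (proof)] -/
theorem legendreSym_m_two [Fact m.Prime] : legendreSym m 2 = -1 :=
  legendreSym_two_of_mod_eight (by have := P.m_mod; omega)

/-- `(q/m) = 1` (`q ≡ (4n)² (mod m)`). [cite: Zywina2025, Lemma 3.2 (proof)] -/
theorem legendreSym_m_q [Fact m.Prime] : legendreSym m q = 1 := by
  have hc : ((q : ℤ) : ZMod m) = (((4 * n : ℤ) ^ 2 : ℤ) : ZMod m) := by
    rw [P.q_eq_int]; push_cast; rw [ZMod.natCast_self]; ring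
  rw [legendreSym_congr hc]
  exact legendreSym.sq_one' m (by exact_mod_cast P.cast_mul_n_ne_zero_m (k := 4) (by norm_num) (by norm_num))

/-- `(r/m) = 1` (`r ≡ (5n)² (mod m)`). [cite: Zywina2025, Lemma 3.2 (proof)] -/
theorem legendreSym_m_r [Fact m.Prime] : legendreSym m r = 1 := by
  have hc : ((r : ℤ) : ZMod m) = (((5 * n : ℤ) ^ 2 : ℤ) : ZMod m) := by
    rw [P.r_eq_int]; push_cast; rw [ZMod.natCast_self]; ring
  rw [legendreSym_congr hc]
  exact legendreSym.sq_one' m (by exact_mod_cast P.cast_mul_n_ne_zero_m (k := 5) (by norm_num) (by norm_num))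

/-! Legendre symbols at `r`: `(-1/r) = -1`, `(3/r) = 1`, `(m/r) = (q/r) = -1`. -/

/-- `(-1/r) = -1` (`r ≡ 3 (mod 4)`). [cite: Zywina2025, Lemma 3.1 (proof)] -/
theorem legendreSym_r_neg_one [Fact r.Prime] : legendreSym r (-1) = -1 :=
  legendreSym_neg_one_of_mod_four (by have := P.r_mod; omega)

/-- `(3/r) = 1` (`r ≡ 11 (mod 12)`). [cite: Zywina2025, Lemma 3.1 (proof)] -/
theorem legendreSym_r_three [Fact r.Prime] : legendreSym r 3 = 1 :=
  legendreSym_three_of_mod_twelve (by have := P.r_mod; omega) (by have := P.r_mod; omega)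

/-- `(m/r) = -1` (`m ≡ -(5n)² (mod r)`). [cite: Zywina2025, Lemma 3.1 (proof)] -/
theorem legendreSym_r_m [Fact r.Prime] : legendreSym r m = -1 := by
  have hc : ((m : ℤ) : ZMod r) = ((-(5 * n : ℤ) ^ 2 : ℤ) : ZMod r) := by
    have : (m : ℤ) = r - 25 * (n : ℤ) ^ 2 := by rw [P.r_eq_int]; ring
    rw [this]; push_cast; rw [ZMod.natCast_self]; ring
  rw [legendreSym_congr hc]
  exact legendreSym_neg_sq (by have := P.r_mod; omega)
    (by exact_mod_cast P.cast_mul_n_ne_zero_r (k := 5) (by norm_num) (by norm_num))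

/-- `(q/r) = -1` (`q ≡ -(3n)² (mod r)`). [cite: Zywina2025, Lemma 3.1 (proof)] -/
theorem legendreSym_r_q [Fact r.Prime] : legendreSym r q = -1 := by
  have hc : ((q : ℤ) : ZMod r) = ((-(3 * n : ℤ) ^ 2 : ℤ) : ZMod r) := by
    have : (q : ℤ) = r - 9 * (n : ℤ) ^ 2 := by rw [P.r_eq_int, P.q_eq_int]; ring
    rw [this]; push_cast; rw [ZMod.natCast_self]; ring
  rw [legendreSym_congr hc]
  exact legendreSym_neg_sq (by have := P.r_mod; omega)
    (by exact_mod_cast P.cast_mul_n_ne_zero_r (k := 3) (by norm_num) (by norm_num))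

end ZywinaParams


namespace ZywinaParams

variable {m n q r : ℕ} (P : ZywinaParams m n q r)
include P

/-! ### Positivity and the discriminant condition -/

/-- `0 < m` in `ℤ`. [folklore] -/
private theorem m_pos_int : (0 : ℤ) < m := by exact_mod_cast P.m_prime.pos
/-- `0 < q` in `ℤ`. [folklore] -/
private theorem q_pos_int : (0 : ℤ) < q := by exact_mod_cast P.q_prime.pos
/-- `0 < r` in `ℤ`. [folklore] -/
private theorem r_pos_int : (0 : ℤ) < r := by exact_mod_cast P.r_prime.pos

/-- `a² - 4b = 25q² - 16qr = 9mq` for `(a, b) = (-5q, 4qr)`. [cite: Zywina2025, §3] -/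
theorem disc_eq : (-5 * (q : ℤ)) ^ 2 - 4 * (4 * q * r) = 9 * m * q := by
  have hq := P.q_eq_int; have hr := P.r_eq_int
  linear_combination 25 * (q : ℤ) * hq - 16 * (q : ℤ) * hr

/-- `b(a² - 4b) ≠ 0` for `E = E_{-5q, 4qr}`. [cite: Zywina2025, §3] -/
theorem hab : (4 * q * r : ℤ) * ((-5 * q) ^ 2 - 4 * (4 * q * r)) ≠ 0 := by
  rw [P.disc_eq]
  have := P.m_pos_int; have := P.q_pos_int; have := P.r_pos_int
  positivity

/-- `a'² - 4b' = 100q² - 36mq = 64qr` for `(a', b') = (10q, 9mq)`. [cite: Zywina2025, §3] -/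
theorem disc_eq' : (10 * (q : ℤ)) ^ 2 - 4 * (9 * m * q) = 64 * q * r := by
  have hq := P.q_eq_int; have hr := P.r_eq_int
  linear_combination 100 * (q : ℤ) * hq - 64 * (q : ℤ) * hr

/-- `b(a² - 4b) ≠ 0` for `E = E_{-5q, 4qr}`. [cite: Zywina2025, §3] -/
theorem hab' : (9 * m * q : ℤ) * ((10 * q) ^ 2 - 4 * (9 * m * q)) ≠ 0 := by
  rw [P.disc_eq']
  have := P.m_pos_int; have := P.q_pos_int; have := P.r_pos_int
  positivity

/-! ### The image of `α` on `E = E_{-5q,4qr}` : `⊆ {1, q, r, qr}` (Zywina, Lemmas 3.2–3.3) -/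

/-- **Zywina's Lemma 3.2 for the rational image**: every class in `α(E(ℚ))`,
`E : y² = x³ - 5q x² + 4qr x`, is one of `[1], [q], [r], [qr]`. [cite: Zywina2025, Lemma 3.2] -/
theorem mem_image_of_mem_range {c : SqUnits ℚ}
    (hc : c ∈ Set.range (⟨0, ((-5 * q : ℤ) : ℚ), 0, ((4 * q * r : ℤ) : ℚ), 0⟩ : WeierstrassCurve ℚ).xSqClass) :
    c ∈ ((({1, (q : ℤ), (r : ℤ), (q : ℤ) * r} : Finset ℤ).image fun d : ℤ => sqClass (d : ℚ)) : Set (SqUnits ℚ)) := by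
  haveI : Fact m.Prime := ⟨P.m_prime⟩
  have hab := P.hab
  haveI := isElliptic_mk_of_ne_zero (F := ℚ) hab
  have hm0 := P.m_pos_int; have hq0 := P.q_pos_int; have hr0 := P.r_pos_int
  obtain ⟨d, hsqf, hdvd, rfl⟩ := exists_squarefree_dvd_sqClass_eq hab hc
  obtain ⟨d', hdd'⟩ := hdvd
  have hdd'Q : (d : ℚ) * d' =
      (⟨0, ((-5 * q : ℤ) : ℚ), 0, ((4 * q * r : ℤ) : ℚ), 0⟩ : WeierstrassCurve ℚ).a₄ := by
    show (d : ℚ) * d' = ((4 * q * r : ℤ) : ℚ)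
    rw [hdd']; push_cast; ring
  obtain ⟨u, z, w, h0, hquart⟩ := (exists_sq_eq_quartic_iff hdd'Q).mpr hc
  obtain ⟨U, Z, W, hcop, hW⟩ := exists_primitive_of_sq_eq_quartic (a := -5 * q) h0 hquart
  have hUZ : U ≠ 0 ∨ Z ≠ 0 := by
    rcases eq_or_ne U 0 with hU | hU
    · rcases eq_or_ne Z 0 with hZ | hZ
      · subst hU hZ; simp at hcop
      · exact Or.inr hZ
    · exact Or.inl hU
  -- `d > 0` (no real points otherwise)
  have hd : 0 < d := by
    rcases lt_or_gt_of_ne hsqf.ne_zero with hneg | hpos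
    · exfalso
      have hd' : d' < 0 := by nlinarith
      exact not_sq_eq_quartic_of_neg hneg hd' (by nlinarith) hUZ hW
    · exact hpos
  -- `(d/m) = 1` (the local condition at `m`)
  have hleg : legendreSym m d = 1 := by
    have hmpp : Prime (m : ℤ) := Nat.prime_iff_prime_int.mp P.m_prime
    have hmd : ¬ (m : ℤ) ∣ d := by
      intro h
      have h' : (m : ℤ) ∣ 4 * q * r := h.trans ⟨d', hdd'⟩
      rw [show (4 : ℤ) * q * r = 4 * ((q : ℤ) * r) by ring] at h'
      rcases hmpp.dvd_or_dvd h' with h1 | h1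
      · exact P.not_m_dvd_small (k := 4) (by norm_num) (by norm_num) (Int.natCast_dvd_natCast.mp h1)
      · rcases hmpp.dvd_or_dvd h1 with h2 | h2
        · exact P.m_ne_q ((Nat.prime_dvd_prime_iff_eq P.m_prime P.q_prime).mp (Int.natCast_dvd_natCast.mp h2))
        · exact P.m_ne_r ((Nat.prime_dvd_prime_iff_eq P.m_prime P.r_prime).mp (Int.natCast_dvd_natCast.mp h2))
    have hB : (-5 * (q : ℤ)) ^ 2 - 4 * d * d' = 9 * m * q := by
      have hq := P.q_eq_int; have hr := P.r_eq_int
      linear_combination 4 * hdd' + 25 * (q : ℤ) * hq - 16 * (q : ℤ) * hr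
    have h1 : (m : ℤ) ∣ (-5 * (q : ℤ)) ^ 2 - 4 * d * d' := by rw [hB]; exact ⟨9 * q, by ring⟩
    have h2 : ¬ (m : ℤ) ^ 2 ∣ (-5 * (q : ℤ)) ^ 2 - 4 * d * d' := by
      rw [hB, pow_two, show (9 : ℤ) * m * q = m * (9 * q) by ring]
      intro h
      have h' : (m : ℤ) ∣ 9 * q := (mul_dvd_mul_iff_left hm0.ne').mp h
      rw [show (9 : ℤ) * q = 3 * (3 * (q : ℤ)) by ring] at h'
      rcases hmpp.dvd_or_dvd h' with h3 | h3
      · exact P.not_m_dvd_small (k := 3) (by norm_num) (by norm_num) (Int.natCast_dvd_natCast.mp h3)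
      rcases hmpp.dvd_or_dvd h3 with h4 | h4
      · exact P.not_m_dvd_small (k := 3) (by norm_num) (by norm_num) (Int.natCast_dvd_natCast.mp h4)
      · exact P.m_ne_q ((Nat.prime_dvd_prime_iff_eq P.m_prime P.q_prime).mp (Int.natCast_dvd_natCast.mp h4))
    have hm2 : m ≠ 2 := by have := P.eleven_le; omega
    obtain ⟨hd0, hsq⟩ := isSquare_zmod_of_sq_eq_quartic hm2 hmd h1 h2 hcop hW
    exact (legendreSym.eq_one_iff m hd0).mpr hsq
  -- positive divisors of `qr` have symbol `1`
  have key : ∀ e : ℤ, e ∣ (q : ℤ) * r → 0 < e → legendreSym m e = 1 := by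
    intro e he hepos
    rcases eq_of_dvd_prime_mul_prime P.q_prime P.r_prime he with
      rfl | rfl | rfl | rfl | rfl | rfl | rfl | rfl
    · exact legendreSym_one'
    · norm_num at hepos
    · exact P.legendreSym_m_q
    · linarith
    · exact P.legendreSym_m_r
    · linarith
    · rw [legendreSym.mul, P.legendreSym_m_q, P.legendreSym_m_r]; norm_num
    · nlinarith
  -- `d ∣ 2qr` (squarefree), then `d ∣ qr` or `d = 2 d₁`
  have h4 : d ∣ ((2 : ℕ) : ℤ) * (((2 : ℕ) : ℤ) * ((q : ℤ) * r)) :=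
    ⟨d', by rw [← hdd']; push_cast; ring⟩
  have h2 := dvd_of_squarefree_of_dvd_prime_sq_mul Nat.prime_two hsqf h4
  rcases dvd_prime_mul Nat.prime_two h2 with h3 | ⟨d₁, rfl, h3⟩
  · rcases eq_of_dvd_prime_mul_prime P.q_prime P.r_prime h3 with
      rfl | rfl | rfl | rfl | rfl | rfl | rfl | rfl
    · exact Finset.mem_coe.mpr (Finset.mem_image.mpr ⟨1, by simp, rfl⟩)
    · norm_num at hd
    · exact Finset.mem_coe.mpr (Finset.mem_image.mpr ⟨(q : ℤ), by simp, rfl⟩)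
    · linarith
    · exact Finset.mem_coe.mpr (Finset.mem_image.mpr ⟨(r : ℤ), by simp, rfl⟩)
    · linarith
    · exact Finset.mem_coe.mpr (Finset.mem_image.mpr ⟨(q : ℤ) * r, by simp, rfl⟩)
    · nlinarith
  · exfalso
    push_cast at hd hleg
    have hd₁ : 0 < d₁ := by linarith
    have h5 := key d₁ h3 hd₁
    rw [legendreSym.mul, P.legendreSym_m_two, h5] at hleg
    norm_num at hleg

/-! ### The image of `α` on `E' = E_{10q, 9mq}` : `⊆ {1, -m, -q, mq}` (Zywina, Lemmas 3.1, 3.3) -/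

/-- **Zywina's Lemma 3.1 for the rational image**: every class in `α(E'(ℚ))`,
`E' : y² = x³ + 10q x² + 9mq x`, is one of `[1], [-m], [-q], [mq]`. [cite: Zywina2025, Lemma 3.1] -/
theorem mem_image_of_mem_range' {c : SqUnits ℚ}
    (hc : c ∈ Set.range (⟨0, ((10 * q : ℤ) : ℚ), 0, ((9 * m * q : ℤ) : ℚ), 0⟩ : WeierstrassCurve ℚ).xSqClass) :
    c ∈ ((({1, -(m : ℤ), -(q : ℤ), (m : ℤ) * q} : Finset ℤ).image fun d : ℤ => sqClass (d : ℚ)) : Set (SqUnits ℚ)) := by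
  haveI : Fact r.Prime := ⟨P.r_prime⟩
  have hab := P.hab'
  haveI := isElliptic_mk_of_ne_zero (F := ℚ) hab
  have hm0 := P.m_pos_int; have hq0 := P.q_pos_int; have hr0 := P.r_pos_int
  have hm4 : (m : ℤ) % 4 = 3 := by have := P.m_mod; omega
  have hq4 : (q : ℤ) % 4 = 3 := by have := P.q_mod; omega
  obtain ⟨d, hsqf, hdvd, rfl⟩ := exists_squarefree_dvd_sqClass_eq hab hc
  obtain ⟨d', hdd'⟩ := hdvd
  have hdd'Q : (d : ℚ) * d' =
      (⟨0, ((10 * q : ℤ) : ℚ), 0, ((9 * m * q : ℤ) : ℚ), 0⟩ : WeierstrassCurve ℚ).a₄ := by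
    show (d : ℚ) * d' = ((9 * m * q : ℤ) : ℚ)
    rw [hdd']; push_cast; ring
  obtain ⟨u, z, w, h0, hquart⟩ := (exists_sq_eq_quartic_iff hdd'Q).mpr hc
  obtain ⟨U, Z, W, hcop, hW⟩ := exists_primitive_of_sq_eq_quartic (a := 10 * q) h0 hquart
  -- `d` is odd
  have hmq4 : ((m : ℤ) * q) % 4 = 1 := by
    rw [Int.mul_emod, hm4, hq4]; norm_num
  have hdodd : d % 2 = 1 := by
    have hodd : Odd (9 * (m : ℤ) * q) := by
      rw [Int.odd_mul, Int.odd_mul]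
      exact ⟨⟨by decide, by rw [Int.odd_iff]; omega⟩, by rw [Int.odd_iff]; omega⟩
    rw [hdd'] at hodd
    exact Int.odd_iff.mp (Int.odd_mul.mp hodd).1
  -- `d ≡ 1 (mod 4)` (the local condition at `2`)
  have hd4 : d % 4 = 1 := by
    by_contra hne
    have hd3 : d % 4 = 3 := by omega
    have hd'3 : d' % 4 = 3 := by
      have h1 : (d * d') % 4 = 1 := by
        rw [← hdd', show (9 : ℤ) * m * q = 9 * ((m : ℤ) * q) by ring, Int.mul_emod, hmq4]; norm_num
      rw [Int.mul_emod, hd3] at h1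
      omega
    have hW' : W ^ 2 = d * U ^ 4 + 2 * (5 * (q : ℤ)) * U ^ 2 * Z ^ 2 + d' * Z ^ 4 := by
      linear_combination hW
    have he : (5 * (q : ℤ)) ^ 2 - d * d' = 16 * ((q : ℤ) * r) := by
      have hq := P.q_eq_int; have hr := P.r_eq_int
      linear_combination hdd' + 25 * (q : ℤ) * hq - 16 * (q : ℤ) * hr
    exact not_sq_eq_quartic_two_adic hd3 hd'3 (by omega) he hcop hW'
  -- `(d/r) = 1` (the local condition at `r`)
  have hleg : legendreSym r d = 1 := by
    have hrpp : Prime (r : ℤ) := Nat.prime_iff_prime_int.mp P.r_prime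
    have hrd : ¬ (r : ℤ) ∣ d := by
      intro h
      have h' : (r : ℤ) ∣ 9 * m * q := h.trans ⟨d', hdd'⟩
      rw [show (9 : ℤ) * m * q = 9 * ((m : ℤ) * q) by ring] at h'
      rcases hrpp.dvd_or_dvd h' with h1 | h1
      · exact P.not_r_dvd_small (k := 9) (by norm_num) (by norm_num) (Int.natCast_dvd_natCast.mp h1)
      · rcases hrpp.dvd_or_dvd h1 with h2 | h2
        · exact P.m_ne_r ((Nat.prime_dvd_prime_iff_eq P.r_prime P.m_prime).mp (Int.natCast_dvd_natCast.mp h2)).symm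
        · exact P.q_ne_r ((Nat.prime_dvd_prime_iff_eq P.r_prime P.q_prime).mp (Int.natCast_dvd_natCast.mp h2)).symm
    have hB : (10 * (q : ℤ)) ^ 2 - 4 * d * d' = 64 * q * r := by
      have hq := P.q_eq_int; have hr := P.r_eq_int
      linear_combination 4 * hdd' + 100 * (q : ℤ) * hq - 64 * (q : ℤ) * hr
    have h1 : (r : ℤ) ∣ (10 * (q : ℤ)) ^ 2 - 4 * d * d' := by rw [hB]; exact ⟨64 * q, by ring⟩
    have h2 : ¬ (r : ℤ) ^ 2 ∣ (10 * (q : ℤ)) ^ 2 - 4 * d * d' := by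
      rw [hB, pow_two, show (64 : ℤ) * q * r = r * (2 ^ 6 * q) by ring]
      intro h
      have h' : (r : ℤ) ∣ 2 ^ 6 * q := (mul_dvd_mul_iff_left hr0.ne').mp h
      rcases hrpp.dvd_or_dvd h' with h3 | h3
      · have h5 : (r : ℤ) ∣ 2 := hrpp.dvd_of_dvd_pow h3
        exact P.not_r_dvd_small (k := 2) (by norm_num) (by norm_num) (Int.natCast_dvd_natCast.mp h5)
      · exact P.q_ne_r ((Nat.prime_dvd_prime_iff_eq P.r_prime P.q_prime).mp (Int.natCast_dvd_natCast.mp h3)).symm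
    have hr2 : r ≠ 2 := by have := P.eleven_le; have := P.m_lt_q; have := P.q_lt_r; omega
    obtain ⟨hd0, hsq⟩ := isSquare_zmod_of_sq_eq_quartic hr2 hrd h1 h2 hcop hW
    exact (legendreSym.eq_one_iff r hd0).mpr hsq
  -- `d ∣ 3mq` (squarefree), then `d ∣ mq` or `d = 3 d₁`
  have h9 : d ∣ ((3 : ℕ) : ℤ) * (((3 : ℕ) : ℤ) * ((m : ℤ) * q)) :=
    ⟨d', by rw [← hdd']; push_cast; ring⟩
  have h3 := dvd_of_squarefree_of_dvd_prime_sq_mul Nat.prime_three hsqf h9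
  rcases dvd_prime_mul Nat.prime_three h3 with h5 | ⟨d₁, rfl, h5⟩
  · rcases eq_of_dvd_prime_mul_prime P.m_prime P.q_prime h5 with
      rfl | rfl | rfl | rfl | rfl | rfl | rfl | rfl
    · exact Finset.mem_coe.mpr (Finset.mem_image.mpr ⟨1, by simp, rfl⟩)
    · omega
    · omega
    · exact Finset.mem_coe.mpr (Finset.mem_image.mpr ⟨-(m : ℤ), by simp, rfl⟩)
    · omega
    · exact Finset.mem_coe.mpr (Finset.mem_image.mpr ⟨-(q : ℤ), by simp, rfl⟩)
    · exact Finset.mem_coe.mpr (Finset.mem_image.mpr ⟨(m : ℤ) * q, by simp, rfl⟩)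
    · omega
  · exfalso
    push_cast at hd4 hleg hdodd
    rw [legendreSym.mul, P.legendreSym_r_three, one_mul] at hleg
    rcases eq_of_dvd_prime_mul_prime P.m_prime P.q_prime h5 with
      rfl | rfl | rfl | rfl | rfl | rfl | rfl | rfl
    · omega
    · rw [P.legendreSym_r_neg_one] at hleg; norm_num at hleg
    · rw [P.legendreSym_r_m] at hleg; norm_num at hleg
    · omega
    · rw [P.legendreSym_r_q] at hleg; norm_num at hleg
    · omega
    · omega
    · rw [show -((m : ℤ) * q) = (-1) * m * q by ring, legendreSym.mul, legendreSym.mul,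
        P.legendreSym_r_neg_one, P.legendreSym_r_m, P.legendreSym_r_q] at hleg
      norm_num at hleg

end ZywinaParams


namespace ZywinaParams

variable {m n q r : ℕ} (P : ZywinaParams m n q r)
include P

/-! ### The known points: `α(E(ℚ)) ⊇ {1, q, r, qr}`, `α(E'(ℚ)) ⊇ {1, -m, -q, mq}` -/

omit P in
/-- `[x t²] = [x]`: a square factor does not change the class (`[4qr] = [qr]`, `[9mq] = [mq]`). [folklore] -/
private theorem sqClass_mul_sq_intCast {x t : ℤ} (hx : x ≠ 0) (ht : t ≠ 0) :
    sqClass (((x * t ^ 2 : ℤ)) : ℚ) = sqClass ((x : ℤ) : ℚ) := by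
  push_cast
  rw [sqClass_mul (by exact_mod_cast hx) (by positivity), sqClass_sq, SqUnits.mul_one]

/-- The image of `α` on `E = E_{-5q,4qr}` is exactly `{[1], [q], [r], [qr]}` — the classes of
`O`, `P₁ = (q, 6nq)`, `P₁ + T` and `T = (0,0)` (Zywina, Lemma 3.3 (ii): `δ'(P₀) = qr`,
`δ'(P₁) = q`). [cite: Zywina2025, Lemma 3.3] -/
theorem range_xSqClass_eq :
    Set.range (⟨0, ((-5 * q : ℤ) : ℚ), 0, ((4 * q * r : ℤ) : ℚ), 0⟩ : WeierstrassCurve ℚ).xSqClass =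
      ((({1, (q : ℤ), (r : ℤ), (q : ℤ) * r} : Finset ℤ).image fun d : ℤ => sqClass (d : ℚ)) :
        Set (SqUnits ℚ)) := by
  have hab := P.hab
  haveI := isElliptic_mk_of_ne_zero (F := ℚ) hab
  have hq0 := P.q_pos_int; have hr0 := P.r_pos_int
  set E : WeierstrassCurve ℚ := ⟨0, ((-5 * q : ℤ) : ℚ), 0, ((4 * q * r : ℤ) : ℚ), 0⟩ with hE
  apply Set.Subset.antisymm
  · intro c hc
    exact P.mem_image_of_mem_range hc
  · -- the four classes are attained
    have h1 : sqClass (((1 : ℤ)) : ℚ) ∈ Set.range E.xSqClass := ⟨0, by simp [sqClass_one]⟩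
    have hT : sqClass ((((q : ℤ) * r : ℤ)) : ℚ) ∈ Set.range E.xSqClass := by
      refine ⟨E.twoTorsionPoint, ?_⟩
      rw [xSqClass_twoTorsionPoint]
      show sqClass (((4 * q * r : ℤ)) : ℚ) = _
      rw [show (4 * q * r : ℤ) = (q * r) * 2 ^ 2 by ring]
      exact sqClass_mul_sq_intCast (mul_pos hq0 hr0).ne' two_ne_zero
    have hP₁ : sqClass (((q : ℤ)) : ℚ) ∈ Set.range E.xSqClass := by
      have heq : E.toAffine.Equation (((q : ℤ)) : ℚ) (((6 * n * q : ℤ)) : ℚ) := by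
        rw [equation_iff_of_isTwoTorsionNF]
        show (((6 * n * q : ℤ)) : ℚ) ^ 2 = (((q : ℤ)) : ℚ) ^ 3 + ((-5 * q : ℤ) : ℚ) * (((q : ℤ)) : ℚ) ^ 2 +
          ((4 * q * r : ℤ) : ℚ) * (((q : ℤ)) : ℚ)
        have hq := P.q_eq_int; have hr := P.r_eq_int
        have key : (6 * n * q : ℤ) ^ 2 = (q : ℤ) ^ 3 + (-5 * q) * (q : ℤ) ^ 2 + (4 * q * r) * q := by
          linear_combination (4 : ℤ) * q ^ 2 * (hq - hr)
        exact_mod_cast key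
      refine ⟨.some _ _ ((Affine.equation_iff_nonsingular).mp heq), ?_⟩
      exact xSqClass_some_of_ne_zero _ (by exact_mod_cast hq0.ne')
    have hr' : sqClass (((r : ℤ)) : ℚ) ∈ Set.range E.xSqClass := by
      have hmul := mul_mem_range_xSqClass E hP₁ hT
      convert hmul using 1
      exact sqClass_eq_mul_of_mul_mul_eq_sq (z := (((q : ℤ) * r : ℤ) : ℚ)) (by exact_mod_cast hq0.ne')
        (by positivity) (by exact_mod_cast hr0.ne') (by push_cast; ring)
    intro c hc
    rw [Finset.coe_image, Set.mem_image] at hc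
    obtain ⟨d, hd, rfl⟩ := hc
    simp only [Finset.coe_insert, Finset.coe_singleton, Set.mem_insert_iff, Set.mem_singleton_iff] at hd
    rcases hd with rfl | rfl | rfl | rfl
    · exact h1
    · exact hP₁
    · exact hr'
    · exact hT

/-- The image of `α` on `E' = E_{10q,9mq}` is exactly `{[1], [-m], [-q], [mq]}` — the classes of
`O`, `Q₁ + T'`, `Q₁ = (-q, 12nq)`, `T' = (0,0)` (Zywina, Lemma 3.3 (i): `δ(Q₀) = mq`,
`δ(Q₁) = -q`). [cite: Zywina2025, Lemma 3.3] -/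
theorem range_xSqClass_eq' :
    Set.range (⟨0, ((10 * q : ℤ) : ℚ), 0, ((9 * m * q : ℤ) : ℚ), 0⟩ : WeierstrassCurve ℚ).xSqClass =
      ((({1, -(m : ℤ), -(q : ℤ), (m : ℤ) * q} : Finset ℤ).image fun d : ℤ => sqClass (d : ℚ)) :
        Set (SqUnits ℚ)) := by
  have hab := P.hab'
  haveI := isElliptic_mk_of_ne_zero (F := ℚ) hab
  have hm0 := P.m_pos_int; have hq0 := P.q_pos_int
  set E : WeierstrassCurve ℚ := ⟨0, ((10 * q : ℤ) : ℚ), 0, ((9 * m * q : ℤ) : ℚ), 0⟩ with hE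
  apply Set.Subset.antisymm
  · intro c hc
    exact P.mem_image_of_mem_range' hc
  · have h1 : sqClass (((1 : ℤ)) : ℚ) ∈ Set.range E.xSqClass := ⟨0, by simp [sqClass_one]⟩
    have hT : sqClass ((((m : ℤ) * q : ℤ)) : ℚ) ∈ Set.range E.xSqClass := by
      refine ⟨E.twoTorsionPoint, ?_⟩
      rw [xSqClass_twoTorsionPoint]
      show sqClass (((9 * m * q : ℤ)) : ℚ) = _
      rw [show (9 * m * q : ℤ) = (m * q) * 3 ^ 2 by ring]
      exact sqClass_mul_sq_intCast (mul_pos hm0 hq0).ne' (by norm_num)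
    have hQ₁ : sqClass (((-(q : ℤ) : ℤ)) : ℚ) ∈ Set.range E.xSqClass := by
      have heq : E.toAffine.Equation (((-(q : ℤ) : ℤ)) : ℚ) (((12 * n * q : ℤ)) : ℚ) := by
        rw [equation_iff_of_isTwoTorsionNF]
        show (((12 * n * q : ℤ)) : ℚ) ^ 2 = (((-(q : ℤ) : ℤ)) : ℚ) ^ 3 +
          ((10 * q : ℤ) : ℚ) * (((-(q : ℤ) : ℤ)) : ℚ) ^ 2 + ((9 * m * q : ℤ) : ℚ) * (((-(q : ℤ) : ℤ)) : ℚ)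
        have hq := P.q_eq_int
        have key : (12 * n * q : ℤ) ^ 2 = (-(q : ℤ)) ^ 3 + (10 * q) * (-(q : ℤ)) ^ 2 + (9 * m * q) * (-(q : ℤ)) := by
          linear_combination (-9 : ℤ) * q ^ 2 * hq
        exact_mod_cast key
      refine ⟨.some _ _ ((Affine.equation_iff_nonsingular).mp heq), ?_⟩
      exact xSqClass_some_of_ne_zero _ (by exact_mod_cast (neg_ne_zero.mpr hq0.ne'))
    have hm' : sqClass (((-(m : ℤ) : ℤ)) : ℚ) ∈ Set.range E.xSqClass := by
      have hmul := mul_mem_range_xSqClass E hQ₁ hT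
      convert hmul using 1
      exact sqClass_eq_mul_of_mul_mul_eq_sq (z := (((m : ℤ) * q : ℤ) : ℚ))
        (by exact_mod_cast (neg_ne_zero.mpr hq0.ne')) (by positivity)
        (by exact_mod_cast (neg_ne_zero.mpr hm0.ne')) (by push_cast; ring)
    intro c hc
    rw [Finset.coe_image, Set.mem_image] at hc
    obtain ⟨d, hd, rfl⟩ := hc
    simp only [Finset.coe_insert, Finset.coe_singleton, Set.mem_insert_iff, Set.mem_singleton_iff] at hd
    rcases hd with rfl | rfl | rfl | rfl
    · exact h1
    · exact hm'
    · exact hQ₁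
    · exact hT

/-! ### Counting: `#α(E(ℚ)) = #α(E'(ℚ)) = 4`, hence `rank E(ℚ) = 2` -/

/-- The four classes `[1], [q], [r], [qr]` are distinct. [folklore] -/
private theorem card_four : (({1, (q : ℤ), (r : ℤ), (q : ℤ) * r} : Finset ℤ).image
    fun d : ℤ => sqClass (d : ℚ)).card = 4 := by
  have hq1 : (q : ℤ) ≠ 1 := by exact_mod_cast P.q_prime.ne_one
  have hr1 : (r : ℤ) ≠ 1 := by exact_mod_cast P.r_prime.ne_one
  have hqr : (q : ℤ) ≠ r := by exact_mod_cast P.q_ne_r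
  have hq0 := P.q_pos_int; have hr0 := P.r_pos_int
  have hsq : ∀ d ∈ ({1, (q : ℤ), (r : ℤ), (q : ℤ) * r} : Finset ℤ), Squarefree d := by
    intro d hd
    simp only [Finset.mem_insert, Finset.mem_singleton] at hd
    rcases hd with rfl | rfl | rfl | rfl
    · exact squarefree_one
    · exact squarefree_intCast_of_prime P.q_prime
    · exact squarefree_intCast_of_prime P.r_prime
    · exact squarefree_intCast_mul_of_prime P.q_prime P.r_prime P.q_ne_r
  rw [Finset.card_image_of_injOn (fun d₁ h₁ d₂ h₂ he => eq_of_sqClass_intCast_eq (hsq d₁ h₁) (hsq d₂ h₂) he)]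
  have h1r : (1 : ℤ) < q := by omega
  have h2r : (1 : ℤ) < r := by omega
  rw [Finset.card_insert_of_notMem, Finset.card_insert_of_notMem, Finset.card_pair]
  · nlinarith
  · simp only [Finset.mem_insert, Finset.mem_singleton, not_or]
    exact ⟨hqr, by nlinarith⟩
  · simp only [Finset.mem_insert, Finset.mem_singleton, not_or]
    exact ⟨hq1.symm, hr1.symm, by nlinarith⟩

/-- The four classes `[1], [q], [r], [qr]` are distinct. [folklore] -/
private theorem card_four' : (({1, -(m : ℤ), -(q : ℤ), (m : ℤ) * q} : Finset ℤ).image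
    fun d : ℤ => sqClass (d : ℚ)).card = 4 := by
  have hm1 : (1 : ℤ) < m := by exact_mod_cast P.m_prime.one_lt
  have hq1 : (1 : ℤ) < q := by exact_mod_cast P.q_prime.one_lt
  have hmq : (m : ℤ) ≠ q := by exact_mod_cast P.m_ne_q
  have hsq : ∀ d ∈ ({1, -(m : ℤ), -(q : ℤ), (m : ℤ) * q} : Finset ℤ), Squarefree d := by
    intro d hd
    simp only [Finset.mem_insert, Finset.mem_singleton] at hd
    rcases hd with rfl | rfl | rfl | rfl
    · exact squarefree_one
    · exact squarefree_neg_intCast_of_prime P.m_prime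
    · exact squarefree_neg_intCast_of_prime P.q_prime
    · exact squarefree_intCast_mul_of_prime P.m_prime P.q_prime P.m_ne_q
  rw [Finset.card_image_of_injOn (fun d₁ h₁ d₂ h₂ he => eq_of_sqClass_intCast_eq (hsq d₁ h₁) (hsq d₂ h₂) he)]
  rw [Finset.card_insert_of_notMem, Finset.card_insert_of_notMem, Finset.card_pair]
  · nlinarith
  · simp only [Finset.mem_insert, Finset.mem_singleton, not_or]
    exact ⟨by omega, by nlinarith⟩
  · simp only [Finset.mem_insert, Finset.mem_singleton, not_or]
    exact ⟨by omega, by omega, by nlinarith⟩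

/-- The `2`-isogenous curve of `E_{-5q,4qr}` is `E' = E_{10q, 9mq}`. [cite: Zywina2025, §3] -/
theorem twoIsogenyCodomain_eq :
    (⟨0, ((-5 * q : ℤ) : ℚ), 0, ((4 * q * r : ℤ) : ℚ), 0⟩ : WeierstrassCurve ℚ).twoIsogenyCodomain =
      ⟨0, ((10 * q : ℤ) : ℚ), 0, ((9 * m * q : ℤ) : ℚ), 0⟩ := by
  rw [twoIsogenyCodomain_mk_intCast, P.disc_eq]
  congr 2
  ring

/-- **Zywina 2025, Theorem 1.2 (rank part), for the integral model**: `rank E_{-5q,4qr}(ℚ) = 2`.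
From `#α(E(ℚ)) · #α(E'(ℚ)) = 2^{rank + 2}` (Silverman–Tate §3.6, tree
`natCard_range_xSqClass_mul`) and `#α(E(ℚ)) = #α(E'(ℚ)) = 4`. [cite: Zywina2025, Thm 1.2] -/
theorem mordellWeilRank_eq_two :
    (⟨0, ((-5 * q : ℤ) : ℚ), 0, ((4 * q * r : ℤ) : ℚ), 0⟩ : WeierstrassCurve ℚ).mordellWeilRank = 2 := by
  have hab := P.hab
  haveI := isElliptic_mk_of_ne_zero (F := ℚ) hab
  have key := natCard_range_xSqClass_mul
    (⟨0, ((-5 * q : ℤ) : ℚ), 0, ((4 * q * r : ℤ) : ℚ), 0⟩ : WeierstrassCurve ℚ)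
  rw [P.twoIsogenyCodomain_eq, P.range_xSqClass_eq, P.range_xSqClass_eq', Nat.card_coe_set_eq,
    Set.ncard_coe_finset, Nat.card_coe_set_eq, Set.ncard_coe_finset, P.card_four, P.card_four',
    show (4 : ℕ) * 4 = 2 ^ 4 by norm_num] at key
  have := Nat.pow_right_injective le_rfl key
  omega

end ZywinaParams



/-! ### The family as stated in the paper -/

/-- Zywina's curve `E_{m,n} : y² = x³ − 5(m+16n²) x² + 4(m+16n²)(m+25n²) x` over `ℚ`.
[cite: Zywina2025, Thm 1.2] -/
def zywinaCurve (m n : ℕ) : WeierstrassCurve ℚ where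
  a₁ := 0
  a₂ := -5 * ((m : ℚ) + 16 * (n : ℚ) ^ 2)
  a₃ := 0
  a₄ := 4 * ((m : ℚ) + 16 * (n : ℚ) ^ 2) * ((m : ℚ) + 25 * (n : ℚ) ^ 2)
  a₆ := 0

/-- Zywina's admissibility condition on `(m, n)`: `n ≥ 1` and `m`, `m + 16n²`, `m + 25n²` are primes
`≡ 11 (mod 24)` (this forces `12 ∣ n`). [cite: Zywina2025, Thm 1.2] -/
def ZywinaAdmissible (m n : ℕ) : Prop :=
  0 < n ∧ m.Prime ∧ (m + 16 * n ^ 2).Prime ∧ (m + 25 * n ^ 2).Prime ∧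
    m % 24 = 11 ∧ (m + 16 * n ^ 2) % 24 = 11 ∧ (m + 25 * n ^ 2) % 24 = 11

/-- An admissible pair gives the unpacked parameter data. [cite: Zywina2025, Thm 1.2] -/
theorem ZywinaAdmissible.params {m n : ℕ} (h : ZywinaAdmissible m n) :
    ZywinaParams m n (m + 16 * n ^ 2) (m + 25 * n ^ 2) :=
  ⟨h.1, h.2.1, h.2.2.1, h.2.2.2.1, rfl, rfl, h.2.2.2.2.1, h.2.2.2.2.2.1, h.2.2.2.2.2.2⟩

/-- `zywinaCurve m n` is the literal integral model `E_{-5q, 4qr}`. [cite: Zywina2025, §3] -/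
theorem zywinaCurve_eq (m n : ℕ) :
    zywinaCurve m n = ⟨0, ((-5 * ((m + 16 * n ^ 2 : ℕ) : ℤ) : ℤ) : ℚ), 0,
      ((4 * ((m + 16 * n ^ 2 : ℕ) : ℤ) * ((m + 25 * n ^ 2 : ℕ) : ℤ) : ℤ) : ℚ), 0⟩ := by
  ext
  · rfl
  · simp only [zywinaCurve]; push_cast; ring
  · rfl
  · simp only [zywinaCurve]; push_cast; ring
  · rfl

/-- `E_{m,n}` is an elliptic curve for admissible `(m, n)` (`Δ = 2⁸·3²·m·q³·r² ≠ 0`).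
[cite: Zywina2025, §3] -/
theorem isElliptic_zywinaCurve {m n : ℕ} (h : ZywinaAdmissible m n) : (zywinaCurve m n).IsElliptic := by
  rw [zywinaCurve_eq]
  exact isElliptic_mk_of_ne_zero (F := ℚ) h.params.hab

/-- **Zywina 2025, Theorem 1.2 (rank part).** For all natural numbers `m, n ≥ 1` such that `m`,
`m + 16n²`, `m + 25n²` are primes `≡ 11 (mod 24)`, the elliptic curve
`E : y² = x³ − 5(m+16n²)x² + 4(m+16n²)(m+25n²)x` has Mordell–Weil rank exactly `2`:
`rank_ℤ E(ℚ) = 2`. (Printed: "`E(ℚ) ≅ ℤ/2ℤ × ℤ²`"; the torsion part is not formalised here.)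
[cite: Zywina2025, Thm 1.2] -/
theorem mordellWeilRank_zywinaCurve {m n : ℕ} (h : ZywinaAdmissible m n) :
    (zywinaCurve m n).mordellWeilRank = 2 := by
  rw [zywinaCurve_eq]
  exact h.params.mordellWeilRank_eq_two

end Literature.NumberTheory.EllipticCurves.Zywina2025

end

/-!
## Appendix (2026-08-25): the rational `2`-torsion, the admissible set, Theorem 1.1 (curve level)

Appended for cell `bsd-rank2`: `#E_{m,n}(ℚ)[2] = 2` (the conjunct `#E(ℚ)[2] = 2¹` of the planner
sketch's descent hypothesis; Zywina, Lemma 3.4), the admissible set `zywinaSet`, the NAMED FACT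
`zywinaSet_infinite` (Zywina §4: infinitely many admissible pairs, by the polynomial Szemerédi
theorem in the primes of Tao–Ziegler — the one printed input of Theorem 1.1 that is not formalised),
and Theorem 1.1 in curve-level form modulo that fact.
-/

noncomputable section

open scoped Classical

open _root_.WeierstrassCurve
open _root_.Polynomial

namespace Literature.NumberTheory.EllipticCurves.Zywina2025

namespace ZywinaParams

variable {m n q r : ℕ} (P : ZywinaParams m n q r)
include P

/-- `9mq` is not a square in `ℤ` (`m ≠ 3`, `m ≠ q` primes). [folklore] -/
private theorem not_isSquare_nine_m_q : ¬ IsSquare (9 * m * q : ℤ) := by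
  rintro ⟨t, ht⟩
  have hmpp : Prime (m : ℤ) := Nat.prime_iff_prime_int.mp P.m_prime
  have hm0 : (0 : ℤ) < m := by exact_mod_cast P.m_prime.pos
  have h11 : 11 ≤ m := by have := P.m_mod; omega
  have hmq : m ≠ q := by have := P.q_eq; have := P.n_pos; nlinarith
  have hmt : (m : ℤ) ∣ t := by
    apply hmpp.dvd_of_dvd_pow (n := 2)
    exact ⟨9 * q, by rw [pow_two, ← ht]; ring⟩
  obtain ⟨s, rfl⟩ := hmt
  have h1 : (m : ℤ) * (9 * q) = m * (m * s ^ 2) := by linear_combination ht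
  have h2 : (9 : ℤ) * q = m * s ^ 2 := mul_left_cancel₀ hm0.ne' h1
  have h3 : (m : ℤ) ∣ 3 * (3 * (q : ℤ)) := ⟨s ^ 2, by linear_combination h2⟩
  rcases hmpp.dvd_or_dvd h3 with h4 | h4
  · have := Int.le_of_dvd (by norm_num) h4; omega
  rcases hmpp.dvd_or_dvd h4 with h5 | h5
  · have := Int.le_of_dvd (by norm_num) h5; omega
  · exact hmq ((Nat.prime_dvd_prime_iff_eq P.m_prime P.q_prime).mp (Int.natCast_dvd_natCast.mp h5))

/-- The `2`-division cubic `4x³ + 4ax² + 4bx = 4x(x² - 5qx + 4qr)` of `E_{-5q,4qr}` has the single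
rational root `x = 0`: the quadratic factor has discriminant `25q² - 16qr = 9mq`, not a square
(Zywina, proof of Lemma 3.4: "the other points of order `2` are defined over `ℚ(√(m(m+16n²)))`").
[cite: Zywina2025, Lemma 3.4 (proof)] -/
theorem isRoot_twoTorsionPolynomial_iff (x : ℚ) :
    (⟨0, ((-5 * q : ℤ) : ℚ), 0, ((4 * q * r : ℤ) : ℚ), 0⟩ : WeierstrassCurve ℚ).twoTorsionPolynomial.toPoly.IsRoot x
      ↔ x = 0 := by
  simp only [twoTorsionPolynomial, Cubic.toPoly, IsRoot.def, eval_add, eval_mul, eval_C, eval_pow,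
    eval_X, b₂, b₄, b₆]
  push_cast
  constructor
  · intro h
    have h' : (4 * x) * (x ^ 2 - 5 * q * x + 4 * q * r) = 0 := by linear_combination h
    rcases mul_eq_zero.mp h' with h1 | h1
    · linarith
    · exfalso
      have dq : (-5 * (q : ℚ)) ^ 2 - 4 * (4 * q * r) = 9 * m * q := by exact_mod_cast P.disc_eq
      have hsq : IsSquare (((9 * m * q : ℤ)) : ℚ) :=
        ⟨2 * x - 5 * q, by push_cast; linear_combination (-4 : ℚ) * h1 - dq⟩
      exact P.not_isSquare_nine_m_q (Rat.isSquare_intCast_iff.mp hsq)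
  · rintro rfl
    ring

/-- **`E(ℚ)[2] ≅ ℤ/2`** for `E = E_{-5q,4qr}`: `#E(ℚ)[2] = 2` (the points `O` and `T = (0,0)`;
Zywina, Lemma 3.4: "The only element of order `2` in `E(ℚ)` is `P₀ = (0,0)`").
[cite: Zywina2025, Lemma 3.4 (proof)] -/
theorem natCard_torsionBy_two :
    Nat.card (AddSubgroup.torsionBy
      (⟨0, ((-5 * q : ℤ) : ℚ), 0, ((4 * q * r : ℤ) : ℚ), 0⟩ : WeierstrassCurve ℚ).toAffine.Point (2 : ℤ)) = 2 := by
  haveI := isElliptic_mk_of_ne_zero (F := ℚ) P.hab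
  have hset : {x : ℚ | (⟨0, ((-5 * q : ℤ) : ℚ), 0, ((4 * q * r : ℤ) : ℚ), 0⟩ :
      WeierstrassCurve ℚ).twoTorsionPolynomial.toPoly.IsRoot x} = {0} := by
    ext x
    simp only [Set.mem_setOf_eq, Set.mem_singleton_iff]
    exact P.isRoot_twoTorsionPolynomial_iff x
  -- the general lemma is stated with the classical `DecidableEq` instance on the base field (the
  -- group law on points takes `[DecidableEq F]`); reduce to that instance (`DecidableEq ℚ` is a
  -- subsingleton)
  suffices aux : ∀ [DecidableEq ℚ], Nat.card (AddSubgroup.torsionBy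
      (⟨0, ((-5 * q : ℤ) : ℚ), 0, ((4 * q * r : ℤ) : ℚ), 0⟩ : WeierstrassCurve ℚ).toAffine.Point (2 : ℤ)) = 2 from
    aux
  intro d
  obtain rfl : d = fun a b => Classical.propDecidable (a = b) := Subsingleton.elim _ _
  have key := natCard_torsionBy_two_eq
    (⟨0, ((-5 * q : ℤ) : ℚ), 0, ((4 * q * r : ℤ) : ℚ), 0⟩ : WeierstrassCurve ℚ) two_ne_zero
  rw [hset, Set.ncard_singleton] at key
  exact key

end ZywinaParams

/-- **`#E_{m,n}(ℚ)[2] = 2`** for admissible `(m, n)`: the rational `2`-torsion of Zywina's curve is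
`{O, (0,0)}` (Lemma 3.4 of the paper proves more: the whole torsion subgroup is `ℤ/2`).
[cite: Zywina2025, Lemma 3.4] -/
theorem natCard_torsionBy_two_zywinaCurve {m n : ℕ} (h : ZywinaAdmissible m n) :
    Nat.card (AddSubgroup.torsionBy (zywinaCurve m n).toAffine.Point (2 : ℤ)) = 2 := by
  rw [zywinaCurve_eq]
  exact h.params.natCard_torsionBy_two

/-! ### The admissible set and Theorem 1.1 -/

/-- The set of Zywina-admissible pairs `(m, n)`. [cite: Zywina2025, Thm 1.2] -/
def zywinaSet : Set (ℕ × ℕ) := {p | ZywinaAdmissible p.1 p.2}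

/-- **Infinitely many admissible pairs** (Zywina 2025, §4, first paragraph of the proof of Theorem 1.1):
"The set of primes that are congruent to `11` modulo `24` has natural density `1/φ(24) = 1/8`. By
[TZ] [Tao–Ziegler, *The primes contain arbitrarily long polynomial progressions*, Acta Math. 201
(2008), Thm 1.3: a subset of the primes of positive relative upper density contains infinitely many
configurations `x + P₁(m), …, x + P_k(m)`, `Pᵢ(0) = 0`], there are infinitely many pairs `(m, n)` of
natural numbers for which `m`, `m + 16n²` and `m + 25n²` are primes congruent to `11` modulo `24`."
NAMED FACT (the polynomial Szemerédi theorem in the primes is far outside the tree).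
[cite: Zywina2025, §4 (proof of Thm 1.1)] -/
def zywinaSet_infinite : Prop := zywinaSet.Infinite

/-- `(m, n) ↦ E_{m,n}` is injective (`a₂ = -5(m+16n²)` and `a₄ = 4(m+16n²)(m+25n²)` recover
`m + 16n²`, `m + 25n²`, hence `n` and `m`). [folklore] -/
private theorem zywinaCurve_injective :
    Function.Injective (fun p : ℕ × ℕ => zywinaCurve p.1 p.2) := by
  rintro ⟨m₁, n₁⟩ ⟨m₂, n₂⟩ h
  have h2 := congrArg WeierstrassCurve.a₂ h
  have h4 := congrArg WeierstrassCurve.a₄ h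
  simp only [zywinaCurve] at h2 h4
  have hq : (m₁ : ℚ) + 16 * (n₁ : ℚ) ^ 2 = m₂ + 16 * (n₂ : ℚ) ^ 2 := by linarith
  rw [hq] at h4
  by_cases h0 : (m₂ : ℚ) + 16 * (n₂ : ℚ) ^ 2 = 0
  · have hm₂ : (m₂ : ℚ) = 0 := by nlinarith [sq_nonneg (n₂ : ℚ), (Nat.cast_nonneg m₂ : (0:ℚ) ≤ m₂)]
    have hn₂ : (n₂ : ℚ) = 0 := by nlinarith [sq_nonneg (n₂ : ℚ), (Nat.cast_nonneg m₂ : (0:ℚ) ≤ m₂)]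
    have hm₁ : (m₁ : ℚ) = 0 := by nlinarith [sq_nonneg (n₁ : ℚ), (Nat.cast_nonneg m₁ : (0:ℚ) ≤ m₁)]
    have hn₁ : (n₁ : ℚ) = 0 := by nlinarith [sq_nonneg (n₁ : ℚ), (Nat.cast_nonneg m₁ : (0:ℚ) ≤ m₁)]
    have e1 : m₁ = m₂ := by exact_mod_cast hm₁.trans hm₂.symm
    have e2 : n₁ = n₂ := by exact_mod_cast hn₁.trans hn₂.symm
    rw [e1, e2]
  · have h5 : (4 * ((m₂ : ℚ) + 16 * (n₂ : ℚ) ^ 2)) * ((m₁ : ℚ) + 25 * (n₁ : ℚ) ^ 2) =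
        (4 * ((m₂ : ℚ) + 16 * (n₂ : ℚ) ^ 2)) * ((m₂ : ℚ) + 25 * (n₂ : ℚ) ^ 2) := by
      linear_combination h4
    have hr : (m₁ : ℚ) + 25 * (n₁ : ℚ) ^ 2 = m₂ + 25 * (n₂ : ℚ) ^ 2 :=
      mul_left_cancel₀ (mul_ne_zero (by norm_num : (4:ℚ) ≠ 0) h0) h5
    have hn : (n₁ : ℚ) ^ 2 = (n₂ : ℚ) ^ 2 := by linarith
    have hn' : (n₁ : ℚ) = n₂ := by
      have h1 : (0 : ℚ) ≤ n₁ := Nat.cast_nonneg _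
      have h2' : (0 : ℚ) ≤ n₂ := Nat.cast_nonneg _
      nlinarith
    have hm : (m₁ : ℚ) = m₂ := by rw [hn'] at hq; linarith
    have e1 : m₁ = m₂ := by exact_mod_cast hm
    have e2 : n₁ = n₂ := by exact_mod_cast hn'
    rw [e1, e2]

/-- **Zywina 2025, Theorem 1.1 (curve-level form), modulo the named fact `zywinaSet_infinite`.**
There are infinitely many elliptic curves `E/ℚ` (here: infinitely many Weierstrass curves
`E_{m,n}`, pairwise distinct) with `rank E(ℚ) = 2`. The printed theorem is "up to isomorphism over
`ℚ̄`" (distinct `j`-invariants, Lemma 4.1); this weaker curve-level count is what the rank theorem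
`mordellWeilRank_zywinaCurve` and the injectivity of `(m,n) ↦ E_{m,n}` give directly.
-- TODO(general form): pairwise distinct `j`-invariants `j(E_{m,n}) = 16(13m+100n²)³/(3²m(m+25n²)²)`
-- (Zywina, Lemma 4.1), i.e. the statement up to `ℚ̄`-isomorphism.
[cite: Zywina2025, Thm 1.1] -/
theorem infinite_setOf_mordellWeilRank_eq_two (h : zywinaSet_infinite) :
    {W : WeierstrassCurve ℚ | W.IsElliptic ∧ W.mordellWeilRank = 2}.Infinite := by
  refine Set.infinite_of_injOn_mapsTo (f := fun p : ℕ × ℕ => zywinaCurve p.1 p.2)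
    (zywinaCurve_injective.injOn) ?_ h
  intro p hp
  exact ⟨isElliptic_zywinaCurve hp, mordellWeilRank_zywinaCurve hp⟩

end Literature.NumberTheory.EllipticCurves.Zywina2025

end


/-!
## Appendix B (2026-08-25): the `j`-invariant, Lemma 4.1, and Theorem 1.1 up to `ℚ̄`-isomorphism

`j(E_{m,n}) = 16(13m + 100n²)³ / (3² m (m + 25n²)²)` (§4), `m, r ∤ 13m + 100n²` (Lemma 4.1),
distinct admissible pairs have distinct `j`-invariants, and hence — modulo the named fact
`zywinaSet_infinite` — the set of `j`-invariants of rank-`2` elliptic curves over `ℚ` is infinite,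
which is Theorem 1.1 exactly as printed. All proved.
-/

noncomputable section

open scoped Classical

open _root_.WeierstrassCurve

namespace Literature.NumberTheory.EllipticCurves.Zywina2025

namespace ZywinaParams

variable {m n q r : ℕ} (P : ZywinaParams m n q r)
include P

/-- **The `j`-invariant** of `E = E_{-5q,4qr}`: `j(E) = 16(13m + 100n²)³ / (3² m (m + 25n²)²)`
(Zywina 2025, §4: "One can verify that `j_E = 16(13m+100n²)³/(3²m(m+25n²)²)`"; here from
`c₄ = 16a² - 48b = 16q(13m + 100n²)` and `Δ = 16b²(a² - 4b) = 2304 m q³ r²`).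
[cite: Zywina2025, §4 (proof of Thm 1.1)] -/
theorem j_eq :
    @WeierstrassCurve.j _ _ (⟨0, ((-5 * q : ℤ) : ℚ), 0, ((4 * q * r : ℤ) : ℚ), 0⟩ : WeierstrassCurve ℚ)
      (isElliptic_mk_of_ne_zero (F := ℚ) P.hab) =
      16 * (13 * m + 100 * (n : ℚ) ^ 2) ^ 3 / (9 * m * (r : ℚ) ^ 2) := by
  haveI := isElliptic_mk_of_ne_zero (F := ℚ) P.hab
  have hm0 : (0 : ℚ) < m := by exact_mod_cast P.m_prime.pos
  have hq0 : (0 : ℚ) < q := by exact_mod_cast P.q_prime.pos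
  have hr0 : (0 : ℚ) < r := by exact_mod_cast P.r_prime.pos
  have hq : (q : ℚ) = m + 16 * (n : ℚ) ^ 2 := by exact_mod_cast P.q_eq_int
  have hr : (r : ℚ) = m + 25 * (n : ℚ) ^ 2 := by exact_mod_cast P.r_eq_int
  have hΔ : (⟨0, ((-5 * q : ℤ) : ℚ), 0, ((4 * q * r : ℤ) : ℚ), 0⟩ : WeierstrassCurve ℚ).Δ =
      2304 * m * (q : ℚ) ^ 3 * (r : ℚ) ^ 2 := by
    rw [Δ_of_isTwoTorsionNF]
    push_cast
    rw [hq, hr]; ring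
  have hc₄ : (⟨0, ((-5 * q : ℤ) : ℚ), 0, ((4 * q * r : ℤ) : ℚ), 0⟩ : WeierstrassCurve ℚ).c₄ =
      16 * q * (13 * m + 100 * (n : ℚ) ^ 2) := by
    rw [c₄, b₂, b₄]
    push_cast
    rw [hq, hr]; ring
  rw [j, Units.val_inv_eq_inv_val, coe_Δ', hΔ, hc₄]
  field_simp
  ring

/-- `m ∤ 13m + 100n²` and `r ∤ 13m + 100n²` (Zywina, Lemma 4.1). [cite: Zywina2025, Lemma 4.1] -/
theorem not_dvd_K :
    ¬ (m : ℤ) ∣ 13 * m + 100 * (n : ℤ) ^ 2 ∧ ¬ (r : ℤ) ∣ 13 * m + 100 * (n : ℤ) ^ 2 := by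
  have hmpp : Prime (m : ℤ) := Nat.prime_iff_prime_int.mp P.m_prime
  have hrpp : Prime (r : ℤ) := Nat.prime_iff_prime_int.mp P.r_prime
  have h11 : 11 ≤ m := by have := P.m_mod; omega
  have hmr : m < r := by have := P.q_eq; have := P.r_eq; have := P.n_pos; nlinarith
  have hnr : n < r := by have := P.r_eq; have := P.n_pos; nlinarith
  have hmn : ¬ m ∣ n := by
    intro h
    have hmq : m ∣ q := by
      rw [P.q_eq]; exact dvd_add dvd_rfl (dvd_mul_of_dvd_right (dvd_pow h two_ne_zero) _)
    have := (Nat.prime_dvd_prime_iff_eq P.m_prime P.q_prime).mp hmq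
    have := P.q_eq; have := P.n_pos; nlinarith
  have hrn : ¬ r ∣ n := fun h => absurd (Nat.le_of_dvd P.n_pos h) (not_le.mpr hnr)
  constructor
  · intro h
    have h1 : (m : ℤ) ∣ 10 * (10 * ((n : ℤ) * n)) := by
      have : (m : ℤ) ∣ 13 * m + 100 * (n : ℤ) ^ 2 - 13 * m := dvd_sub h ⟨13, by ring⟩
      rw [show (13 : ℤ) * m + 100 * (n : ℤ) ^ 2 - 13 * m = 10 * (10 * ((n : ℤ) * n)) by ring] at this
      exact this
    have h10 : ¬ (m : ℤ) ∣ 10 := fun h' => by have := Int.le_of_dvd (by norm_num) h'; omega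
    rcases hmpp.dvd_or_dvd h1 with h2 | h2
    · exact h10 h2
    rcases hmpp.dvd_or_dvd h2 with h3 | h3
    · exact h10 h3
    rcases hmpp.dvd_or_dvd h3 with h4 | h4 <;> exact hmn (Int.natCast_dvd_natCast.mp h4)
  · intro h
    -- `13m + 100n² = 13r - 225n²`
    have h1 : (r : ℤ) ∣ 15 * (15 * ((n : ℤ) * n)) := by
      have : (r : ℤ) ∣ 13 * r - (13 * m + 100 * (n : ℤ) ^ 2) := dvd_sub ⟨13, by ring⟩ h
      rw [show (13 : ℤ) * r - (13 * m + 100 * (n : ℤ) ^ 2) = 15 * (15 * ((n : ℤ) * n)) by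
        rw [P.r_eq_int]; ring] at this
      exact this
    have hr24 := P.r_mod
    have h15 : ¬ (r : ℤ) ∣ 15 := fun h' => by have := Int.le_of_dvd (by norm_num) h'; omega
    rcases hrpp.dvd_or_dvd h1 with h2 | h2
    · exact h15 h2
    rcases hrpp.dvd_or_dvd h2 with h3 | h3
    · exact h15 h3
    rcases hrpp.dvd_or_dvd h3 with h4 | h4 <;> exact hrn (Int.natCast_dvd_natCast.mp h4)

end ZywinaParams

/-- `j` depends only on the curve (the `IsElliptic` instance is a proposition). [folklore] -/
private theorem j_congr {W₁ W₂ : WeierstrassCurve ℚ} (h : W₁ = W₂) (i₁ : W₁.IsElliptic)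
    (i₂ : W₂.IsElliptic) : @WeierstrassCurve.j _ _ W₁ i₁ = @WeierstrassCurve.j _ _ W₂ i₂ := by
  subst h; rfl

/-- The `j`-invariant of `E_{m,n}` for admissible `(m, n)`: `16(13m+100n²)³/(3²m(m+25n²)²)`.
[cite: Zywina2025, §4 (proof of Thm 1.1)] -/
theorem j_zywinaCurve {m n : ℕ} (h : ZywinaAdmissible m n) :
    @WeierstrassCurve.j _ _ (zywinaCurve m n) (isElliptic_zywinaCurve h) =
      16 * (13 * m + 100 * (n : ℚ) ^ 2) ^ 3 / (9 * m * ((m : ℚ) + 25 * (n : ℚ) ^ 2) ^ 2) := by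
  rw [j_congr (zywinaCurve_eq m n) (isElliptic_zywinaCurve h)
    (isElliptic_mk_of_ne_zero (F := ℚ) h.params.hab), h.params.j_eq]
  push_cast
  ring

/-- **Distinct admissible pairs give distinct `j`-invariants** (Zywina, §4: "we can recover the pair
`(m, n)` from the `j`-invariant of `E`", via Lemma 4.1: `16(13m+100n²)³/(3²m(m+25n²)²)` is in lowest
terms, so `m` and `r = m + 25n²` are read off the denominator). Here: from
`K₁³ m₂ r₂² = K₂³ m₁ r₁²` and `mᵢ, rᵢ ∤ Kᵢ`, the primes `m₁ < r₁` and `m₂ < r₂` match up.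
[cite: Zywina2025, Lemma 4.1] -/
theorem eq_of_j_eq {m₁ n₁ m₂ n₂ : ℕ} (h₁ : ZywinaAdmissible m₁ n₁) (h₂ : ZywinaAdmissible m₂ n₂)
    (hj : @WeierstrassCurve.j _ _ (zywinaCurve m₁ n₁) (isElliptic_zywinaCurve h₁) =
      @WeierstrassCurve.j _ _ (zywinaCurve m₂ n₂) (isElliptic_zywinaCurve h₂)) :
    m₁ = m₂ ∧ n₁ = n₂ := by
  rw [j_zywinaCurve h₁, j_zywinaCurve h₂] at hj
  have P₁ := h₁.params
  have P₂ := h₂.params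
  set r₁ : ℕ := m₁ + 25 * n₁ ^ 2 with hr₁
  set r₂ : ℕ := m₂ + 25 * n₂ ^ 2 with hr₂
  have hm₁ : (0 : ℚ) < m₁ := by exact_mod_cast P₁.m_prime.pos
  have hm₂ : (0 : ℚ) < m₂ := by exact_mod_cast P₂.m_prime.pos
  have hr₁0 : (0 : ℚ) < r₁ := by exact_mod_cast P₁.r_prime.pos
  have hr₂0 : (0 : ℚ) < r₂ := by exact_mod_cast P₂.r_prime.pos
  have hr₁Q : ((m₁ : ℚ) + 25 * (n₁ : ℚ) ^ 2) = r₁ := by rw [hr₁]; push_cast; ring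
  have hr₂Q : ((m₂ : ℚ) + 25 * (n₂ : ℚ) ^ 2) = r₂ := by rw [hr₂]; push_cast; ring
  rw [hr₁Q, hr₂Q] at hj
  -- clear denominators: `K₁³ m₂ r₂² = K₂³ m₁ r₁²` in `ℤ`
  set K₁ : ℤ := 13 * m₁ + 100 * (n₁ : ℤ) ^ 2 with hK₁
  set K₂ : ℤ := 13 * m₂ + 100 * (n₂ : ℤ) ^ 2 with hK₂
  have hZ : K₁ ^ 3 * m₂ * (r₂ : ℤ) ^ 2 = K₂ ^ 3 * m₁ * (r₁ : ℤ) ^ 2 := by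
    have hjQ : (16 * (13 * (m₁ : ℚ) + 100 * (n₁ : ℚ) ^ 2) ^ 3) * (9 * m₂ * (r₂ : ℚ) ^ 2) =
        (16 * (13 * (m₂ : ℚ) + 100 * (n₂ : ℚ) ^ 2) ^ 3) * (9 * m₁ * (r₁ : ℚ) ^ 2) := by
      rw [div_eq_div_iff (by positivity) (by positivity)] at hj
      exact hj
    have : ((K₁ ^ 3 * m₂ * (r₂ : ℤ) ^ 2 : ℤ) : ℚ) = ((K₂ ^ 3 * m₁ * (r₁ : ℤ) ^ 2 : ℤ) : ℚ) := by
      push_cast [hK₁, hK₂]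
      linear_combination (1 / 144 : ℚ) * hjQ
    exact_mod_cast this
  obtain ⟨hmK₁, hrK₁⟩ := P₁.not_dvd_K
  obtain ⟨hmK₂, hrK₂⟩ := P₂.not_dvd_K
  have hmpp₁ : Prime (m₁ : ℤ) := Nat.prime_iff_prime_int.mp P₁.m_prime
  have hrpp₁ : Prime (r₁ : ℤ) := Nat.prime_iff_prime_int.mp P₁.r_prime
  have hmpp₂ : Prime (m₂ : ℤ) := Nat.prime_iff_prime_int.mp P₂.m_prime
  have hrpp₂ : Prime (r₂ : ℤ) := Nat.prime_iff_prime_int.mp P₂.r_prime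
  have hlt₁ : m₁ < r₁ := by have := P₁.n_pos; rw [hr₁]; nlinarith
  have hlt₂ : m₂ < r₂ := by have := P₂.n_pos; rw [hr₂]; nlinarith
  -- a prime `p ∤ K` dividing `K³ · a · b²` (with `a, b` prime) is `a` or `b`
  have key : ∀ {p a b : ℕ} {K : ℤ}, p.Prime → a.Prime → b.Prime → ¬ (p : ℤ) ∣ K →
      (p : ℤ) ∣ K ^ 3 * a * (b : ℤ) ^ 2 → p = a ∨ p = b := by
    intro p a b K hp ha hb hpK hdvd
    have hpp : Prime (p : ℤ) := Nat.prime_iff_prime_int.mp hp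
    rcases hpp.dvd_or_dvd hdvd with h1 | h1
    · rcases hpp.dvd_or_dvd h1 with h2 | h2
      · exact absurd (hpp.dvd_of_dvd_pow h2) hpK
      · exact Or.inl ((Nat.prime_dvd_prime_iff_eq hp ha).mp (Int.natCast_dvd_natCast.mp h2))
    · exact Or.inr ((Nat.prime_dvd_prime_iff_eq hp hb).mp
        (Int.natCast_dvd_natCast.mp (hpp.dvd_of_dvd_pow h1)))
  have hm₁' : m₁ = m₂ ∨ m₁ = r₂ :=
    key P₁.m_prime P₂.m_prime P₂.r_prime hmK₁ ⟨K₂ ^ 3 * (r₁ : ℤ) ^ 2, by rw [hZ]; ring⟩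
  have hr₁' : r₁ = m₂ ∨ r₁ = r₂ :=
    key P₁.r_prime P₂.m_prime P₂.r_prime hrK₁ ⟨K₂ ^ 3 * m₁ * r₁, by rw [hZ]; ring⟩
  have hm₂' : m₂ = m₁ ∨ m₂ = r₁ :=
    key P₂.m_prime P₁.m_prime P₁.r_prime hmK₂ ⟨K₁ ^ 3 * (r₂ : ℤ) ^ 2, by rw [← hZ]; ring⟩
  have hr₂' : r₂ = m₁ ∨ r₂ = r₁ :=
    key P₂.r_prime P₁.m_prime P₁.r_prime hrK₂ ⟨K₁ ^ 3 * m₂ * r₂, by rw [← hZ]; ring⟩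
  have hm : m₁ = m₂ := by omega
  have hrr : r₁ = r₂ := by omega
  refine ⟨hm, ?_⟩
  have : n₁ ^ 2 = n₂ ^ 2 := by rw [hr₁, hr₂] at hrr; omega
  exact Nat.pow_left_injective two_ne_zero this

/-- **Zywina 2025, Theorem 1.1, as printed** ("There are infinitely many elliptic curves over `ℚ`,
up to isomorphism over `ℚ̄`, of rank `2`"), modulo the named fact `zywinaSet_infinite`: the set of
`j`-invariants of elliptic curves `E/ℚ` with `rank E(ℚ) = 2` is infinite (distinct admissible pairs
give distinct `j`-invariants, `eq_of_j_eq`). [cite: Zywina2025, Thm 1.1] -/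
theorem infinite_setOf_j_mordellWeilRank_eq_two (h : zywinaSet_infinite) :
    {j : ℚ | ∃ (W : WeierstrassCurve ℚ) (hW : W.IsElliptic),
      @WeierstrassCurve.j _ _ W hW = j ∧ W.mordellWeilRank = 2}.Infinite := by
  let f : ℕ × ℕ → ℚ := fun p =>
    if hp : ZywinaAdmissible p.1 p.2 then
      @WeierstrassCurve.j _ _ (zywinaCurve p.1 p.2) (isElliptic_zywinaCurve hp) else 0
  have hinj : Set.InjOn f zywinaSet := by
    rintro ⟨m₁, n₁⟩ h₁ ⟨m₂, n₂⟩ h₂ he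
    have h₁' : ZywinaAdmissible m₁ n₁ := h₁
    have h₂' : ZywinaAdmissible m₂ n₂ := h₂
    simp only [f, dif_pos h₁', dif_pos h₂'] at he
    obtain ⟨rfl, rfl⟩ := eq_of_j_eq h₁' h₂' he
    rfl
  refine Set.infinite_of_injOn_mapsTo hinj ?_ h
  rintro ⟨m, n⟩ hp
  have hp' : ZywinaAdmissible m n := hp
  exact ⟨zywinaCurve m n, isElliptic_zywinaCurve hp', by simp only [f, dif_pos hp'],
    mordellWeilRank_zywinaCurve hp'⟩

/-! ## Appendix C. The Selmer groups of the two isogenies and the `φ`-parts of `Ш`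
(Zywina 2025, Lemmas 3.1–3.3 in full)

The local arguments of Lemmas 3.1/3.2, this time over `ℚ_p`: a `ℚ_p`-point of
`w² = d u⁴ + a u²z² + d' z⁴` is moved to a `ℤ_p`-chart (`t = z/u` or `t = u/z`, whichever is integral),
and the chart equation is reduced modulo `p` (`PadicInt.toZMod`) at an odd prime, resp. modulo `16`
(`PadicInt.toZModPow 4`) at `p = 2`, landing in the integral lemmas of the first part. With the tree's
explicit Selmer sets `twoIsogenySelmerGroup a b` (squarefree `d ∣ b` with the quartic everywhere locally
soluble; Silverman X.4.9) this gives `S(-5q, 4qr) = {1, q, r, qr}` and `S(10q, 9mq) = {1, -m, -q, mq}`,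
and the tree's count `2^{dim S} = #α(E(ℚ)) · #(Ш ∩ im Ξ)` (`two_pow_twoIsogenySelmerRank_eq_natCard_mul`)
then forces `Ш ∩ im Ξ = ⊥` for both isogenies. -/

open _root_.WeierstrassCurve.Affine (sqClass)

section LocalPadic

/-- **Chart reduction.** A `ℚ_p`-point `(u : z : w)`, `(u, z) ≠ (0, 0)`, of `w² = d u⁴ + a u²z² + d' z⁴`
gives `t, s ∈ ℤ_p` with `s² = e + a t² + e' t⁴` for `(e, e') = (d, d')` (divide by `u⁴`, `t = z/u`, when
`|z| ≤ |u|`) or `(e, e') = (d', d)` (divide by `z⁴`, `t = u/z`, when `|u| ≤ |z|`); `s` is integral because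
`s²` is. [cite: Zywina2025, Lemma 3.1 (proof: "after scaling we may assume …")] -/
theorem exists_padicInt_of_isSoluble {p : ℕ} [Fact p.Prime] {a d d' : ℤ}
    (h : ((twoIsogenyQuartic a d d').map (Int.castRingHom ℚ_[p])).IsSoluble) :
    ∃ e e' : ℤ, ((e = d ∧ e' = d') ∨ (e = d' ∧ e' = d)) ∧
      ∃ t s : ℤ_[p], s ^ 2 = e + a * t ^ 2 + e' * t ^ 4 := by
  obtain ⟨u, z, w, h0, h⟩ := h
  rw [eval_map_twoIsogenyQuartic] at h
  simp only [eq_intCast] at h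
  -- the affine chart through the coordinate of larger norm
  have chart : ∀ {e e' : ℤ} {x y : ℚ_[p]}, x ≠ 0 → ‖y‖ ≤ ‖x‖ →
      w ^ 2 = e * x ^ 4 + a * x ^ 2 * y ^ 2 + e' * y ^ 4 →
      ∃ t s : ℤ_[p], s ^ 2 = e + a * t ^ 2 + e' * t ^ 4 := by
    intro e e' x y hx hyx hw
    have ht : ‖y / x‖ ≤ 1 := by
      rw [norm_div]; exact div_le_one_of_le₀ hyx (norm_nonneg _)
    set T : ℤ_[p] := ⟨y / x, ht⟩ with hT
    have hs_eq : (w / x ^ 2) ^ 2 = (((e : ℤ_[p]) + a * T ^ 2 + e' * T ^ 4 : ℤ_[p]) : ℚ_[p]) := by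
      push_cast [hT]
      field_simp
      linear_combination hw
    have hs : ‖w / x ^ 2‖ ≤ 1 := by
      have h1 : ‖w / x ^ 2‖ ^ 2 ≤ 1 := by
        rw [← norm_pow, hs_eq]; exact PadicInt.norm_le_one _
      exact (pow_le_one_iff_of_nonneg (norm_nonneg _) two_ne_zero).mp h1
    refine ⟨T, ⟨w / x ^ 2, hs⟩, ?_⟩
    apply Subtype.ext
    push_cast
    exact hs_eq
  rcases le_total ‖z‖ ‖u‖ with hzu | huz
  · have hu : u ≠ 0 := by
      rintro rfl
      rcases h0 with hu | hz
      · exact hu rfl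
      · exact hz (norm_le_zero_iff.mp (by simpa using hzu))
    exact ⟨d, d', Or.inl ⟨rfl, rfl⟩, chart hu hzu h⟩
  · have hz : z ≠ 0 := by
      rintro rfl
      rcases h0 with hu | hz
      · exact hu (norm_le_zero_iff.mp (by simpa using huz))
      · exact hz rfl
    exact ⟨d', d, Or.inr ⟨rfl, rfl⟩, chart hz huz (by linear_combination h)⟩

/-- In `ℤ_p`: `x mod p = 0 ↔ p ∣ x`. [folklore] -/
private theorem toZMod_eq_zero_iff {p : ℕ} [Fact p.Prime] (x : ℤ_[p]) :
    PadicInt.toZMod x = 0 ↔ (p : ℤ_[p]) ∣ x := by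
  rw [← RingHom.mem_ker, PadicInt.ker_toZMod, PadicInt.maximalIdeal_eq_span_p,
    Ideal.mem_span_singleton]

/-- An integer is divisible by `p` in `ℤ_p` iff it is in `ℤ`. [folklore] -/
private theorem p_dvd_intCast_iff {p : ℕ} [Fact p.Prime] (n : ℤ) :
    (p : ℤ_[p]) ∣ (n : ℤ_[p]) ↔ (p : ℤ) ∣ n := by
  rw [← toZMod_eq_zero_iff, map_intCast, ZMod.intCast_zmod_eq_zero_iff_dvd]

/-- **The local condition at an odd prime, over `ℤ_p`** (the `p`-adic form of
`isSquare_zmod_of_sq_eq_quartic`). Let `p` be an odd prime with `p ∤ d` and `p ∥ a² - 4dd'`. If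
`W² = d U⁴ + a U²Z² + d' Z⁴` with `U, Z, W ∈ ℤ_p` and not both `U, Z ∈ pℤ_p`, then `d` is a non-zero
square modulo `p`: with `s = 2dU² + aZ²`, `4dW² = s² - (a² - 4dd')Z⁴`; `p ∣ s` is impossible
(`p ∣ Z ⇒ p ∣ U`; `p ∤ Z ⇒ p ∣ W ⇒ p² ∣ (a² - 4dd')Z⁴`), and `p ∤ s` exhibits `d ≡ (s/2W)² (mod p)`.
[cite: Zywina2025, Lemma 3.1 (proof)] -/
theorem isSquare_zmod_of_sq_eq_quartic_padicInt {p : ℕ} [hp : Fact p.Prime] (hp2 : p ≠ 2)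
    {d a d' : ℤ} {U Z W : ℤ_[p]} (hpd : ¬ (p : ℤ) ∣ d) (hpB : (p : ℤ) ∣ a ^ 2 - 4 * d * d')
    (hpB2 : ¬ (p : ℤ) ^ 2 ∣ a ^ 2 - 4 * d * d') (hprim : ¬ ((p : ℤ_[p]) ∣ U ∧ (p : ℤ_[p]) ∣ Z))
    (h : W ^ 2 = d * U ^ 4 + a * U ^ 2 * Z ^ 2 + d' * Z ^ 4) :
    (d : ZMod p) ≠ 0 ∧ IsSquare (d : ZMod p) := by
  have hpp : Prime (p : ℤ_[p]) := PadicInt.prime_p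
  set S : ℤ_[p] := 2 * d * U ^ 2 + a * Z ^ 2 with hS
  obtain ⟨B₁, hB₁⟩ := hpB
  have hpB₁ : ¬ (p : ℤ_[p]) ∣ (B₁ : ℤ_[p]) := by
    rw [p_dvd_intCast_iff]
    rintro hB
    apply hpB2
    rw [hB₁, pow_two]
    exact mul_dvd_mul_left _ hB
  have key : 4 * (d : ℤ_[p]) * W ^ 2 = S ^ 2 - (p : ℤ_[p]) * B₁ * Z ^ 4 := by
    have e : ((a ^ 2 - 4 * d * d' : ℤ) : ℤ_[p]) = (p : ℤ) * B₁ := by rw [hB₁]; push_cast; ring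
    push_cast at e
    rw [h, hS]
    linear_combination (-1 : ℤ_[p]) * Z ^ 4 * e
  have hp2' : ¬ (p : ℤ_[p]) ∣ 2 := fun h2 => by
    have h2' : (p : ℤ) ∣ 2 := by rw [← p_dvd_intCast_iff (p := p)]; simpa using h2
    have : (p : ℤ) ≤ 2 := Int.le_of_dvd (by norm_num) h2'
    have := hp.out.two_le
    omega
  have hpd' : ¬ (p : ℤ_[p]) ∣ (d : ℤ_[p]) := by rwa [p_dvd_intCast_iff]
  have hd0 : (d : ZMod p) ≠ 0 := by
    rwa [Ne, ZMod.intCast_zmod_eq_zero_iff_dvd]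
  refine ⟨hd0, ?_⟩
  by_cases hpS : (p : ℤ_[p]) ∣ S
  · exfalso
    by_cases hpZ : (p : ℤ_[p]) ∣ Z
    · -- `p ∣ 2 d U²`, so `p ∣ U`: excluded
      have h1 : (p : ℤ_[p]) ∣ 2 * d * U ^ 2 := by
        have : (p : ℤ_[p]) ∣ S - a * Z ^ 2 := dvd_sub hpS (dvd_mul_of_dvd_right (dvd_pow hpZ two_ne_zero) _)
        simpa [hS] using this
      have hpU : (p : ℤ_[p]) ∣ U := by
        rcases hpp.dvd_or_dvd h1 with h2 | h2
        · rcases hpp.dvd_or_dvd h2 with h3 | h3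
          · exact absurd h3 hp2'
          · exact absurd h3 hpd'
        · exact hpp.dvd_of_dvd_pow h2
      exact hprim ⟨hpU, hpZ⟩
    · -- `p ∤ Z`: `p ∣ W`, then `p² ∣ p B₁ Z⁴`, `p ∣ B₁ Z⁴`
      have h1 : (p : ℤ_[p]) ∣ 4 * d * W ^ 2 := by
        rw [key]
        exact dvd_sub (dvd_pow hpS two_ne_zero) (dvd_mul_of_dvd_left (dvd_mul_right _ _) _)
      have hpW : (p : ℤ_[p]) ∣ W := by
        rcases hpp.dvd_or_dvd h1 with h2 | h2
        · rcases hpp.dvd_or_dvd h2 with h3 | h3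
          · exact absurd (hpp.dvd_of_dvd_pow (show (p : ℤ_[p]) ∣ 2 ^ 2 by norm_num; exact h3)) hp2'
          · exact absurd h3 hpd'
        · exact hpp.dvd_of_dvd_pow h2
      have h2 : (p : ℤ_[p]) * p ∣ (p : ℤ_[p]) * (B₁ * Z ^ 4) := by
        have e : (p : ℤ_[p]) * (B₁ * Z ^ 4) = S ^ 2 - 4 * d * W ^ 2 := by rw [key]; ring
        rw [e, ← pow_two]
        exact dvd_sub (pow_dvd_pow_of_dvd hpS 2)
          (Dvd.dvd.mul_left (pow_dvd_pow_of_dvd hpW 2) (4 * d))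
      have h3 : (p : ℤ_[p]) ∣ B₁ * Z ^ 4 := (mul_dvd_mul_iff_left hpp.ne_zero).mp h2
      rcases hpp.dvd_or_dvd h3 with h4 | h4
      · exact hpB₁ h4
      · exact hpZ (hpp.dvd_of_dvd_pow h4)
  · -- `p ∤ s`: reduce modulo `p`
    have hS0 : PadicInt.toZMod S ≠ 0 := by rwa [Ne, toZMod_eq_zero_iff]
    have key' : (4 : ZMod p) * d * PadicInt.toZMod W ^ 2 = PadicInt.toZMod S ^ 2 := by
      have := congrArg PadicInt.toZMod key
      simp only [map_mul, map_sub, map_pow, map_natCast, map_intCast, map_ofNat,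
        ZMod.natCast_self, zero_mul, sub_zero] at this
      exact this
    have h20 : (2 : ZMod p) ≠ 0 := by
      have h2Z : ¬ (p : ℤ) ∣ 2 := fun h2 => by
        have : (p : ℤ) ≤ 2 := Int.le_of_dvd (by norm_num) h2
        have := hp.out.two_le
        omega
      have : ((2 : ℤ) : ZMod p) ≠ 0 := by rwa [Ne, ZMod.intCast_zmod_eq_zero_iff_dvd]
      simpa using this
    have hW0 : PadicInt.toZMod W ≠ 0 := by
      intro hW
      rw [hW, zero_pow two_ne_zero, mul_zero] at key'
      exact hS0 (pow_eq_zero_iff two_ne_zero |>.mp key'.symm)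
    refine ⟨PadicInt.toZMod S / (2 * PadicInt.toZMod W), ?_⟩
    field_simp
    linear_combination key'

/-- **The local condition at an odd prime, `p`-adically**: for an odd prime `p` with `p ∤ d` and
`p ∥ a² - 4dd'`, a non-trivial `ℚ_p`-point of `w² = d u⁴ + a u²z² + d' z⁴` forces `d` to be a non-zero
square modulo `p` (both `ℤ_p`-charts are instances of the previous lemma, with `U = 1` or `Z = 1`).
[cite: Zywina2025, Lemma 3.1 (proof)] -/
theorem isSquare_zmod_of_isSoluble_padic {p : ℕ} [Fact p.Prime] (hp2 : p ≠ 2) {a d d' : ℤ}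
    (hpd : ¬ (p : ℤ) ∣ d) (hpB : (p : ℤ) ∣ a ^ 2 - 4 * d * d') (hpB2 : ¬ (p : ℤ) ^ 2 ∣ a ^ 2 - 4 * d * d')
    (h : ((twoIsogenyQuartic a d d').map (Int.castRingHom ℚ_[p])).IsSoluble) :
    (d : ZMod p) ≠ 0 ∧ IsSquare (d : ZMod p) := by
  have h1 : ¬ (p : ℤ_[p]) ∣ 1 := PadicInt.prime_p.not_dvd_one
  obtain ⟨e, e', hee, t, s, hs⟩ := exists_padicInt_of_isSoluble h
  rcases hee with ⟨rfl, rfl⟩ | ⟨rfl, rfl⟩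
  · exact isSquare_zmod_of_sq_eq_quartic_padicInt hp2 hpd hpB hpB2 (U := 1) (Z := t) (W := s)
      (fun hh => h1 hh.1) (by rw [hs]; ring)
  · exact isSquare_zmod_of_sq_eq_quartic_padicInt hp2 hpd hpB hpB2 (U := t) (Z := 1) (W := s)
      (fun hh => h1 hh.2) (by rw [hs]; ring)

/-- **The local condition at `2`, modulo `16`** (the congruence form of `not_sq_eq_quartic_two_adic`):
for `d ≡ d' ≡ c ≡ 3 (mod 4)` and `c² ≡ dd' (mod 16)`, the congruence
`W² ≡ d U⁴ + 2c U²Z² + d' Z⁴ (mod 16)` has no solution with `U` or `Z` odd.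
[cite: Zywina2025, Lemma 3.1 (proof)] -/
theorem not_sq_eq_quartic_mod_sixteen {d d' c e U Z W k : ℤ} (hd : d % 4 = 3) (hd' : d' % 4 = 3)
    (hc : c % 4 = 3) (he : c ^ 2 - d * d' = 16 * e) (hodd : Odd U ∨ Odd Z)
    (h : W ^ 2 = d * U ^ 4 + 2 * c * U ^ 2 * Z ^ 2 + d' * Z ^ 4 + 16 * k) : False := by
  have hW := sq_emod_sixteen W
  rcases Int.even_or_odd U with hU | hU <;> rcases Int.even_or_odd Z with hZ | hZ
  · rcases hodd with hU' | hZ'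
    · exact (Int.not_odd_iff_even.mpr hU) hU'
    · exact (Int.not_odd_iff_even.mpr hZ) hZ'
  · obtain ⟨u, rfl⟩ := hU
    have hZ2 := sq_emod_eight_of_odd hZ
    have e1 : W ^ 2 = 4 * (4 * d * u ^ 4 + 2 * c * u ^ 2 * Z ^ 2 + 4 * k) + d' * (Z ^ 2) ^ 2 := by
      rw [h]; ring
    have hP : d' * (Z ^ 2) ^ 2 % 4 = 3 := by
      rw [Int.mul_emod, pow_two, Int.mul_emod (Z ^ 2)]
      have : Z ^ 2 % 4 = 1 := by omega
      rw [this, hd']; norm_num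
    generalize d' * (Z ^ 2) ^ 2 = P at e1 hP
    generalize 4 * d * u ^ 4 + 2 * c * u ^ 2 * Z ^ 2 + 4 * k = A at e1
    generalize W ^ 2 = w2 at hW e1
    omega
  · obtain ⟨z, rfl⟩ := hZ
    have hU2 := sq_emod_eight_of_odd hU
    have e1 : W ^ 2 = 4 * (4 * d' * z ^ 4 + 2 * c * U ^ 2 * z ^ 2 + 4 * k) + d * (U ^ 2) ^ 2 := by
      rw [h]; ring
    have hP : d * (U ^ 2) ^ 2 % 4 = 3 := by
      rw [Int.mul_emod, pow_two, Int.mul_emod (U ^ 2)]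
      have : U ^ 2 % 4 = 1 := by omega
      rw [this, hd]; norm_num
    generalize d * (U ^ 2) ^ 2 = P at e1 hP
    generalize 4 * d' * z ^ 4 + 2 * c * U ^ 2 * z ^ 2 + 4 * k = A at e1
    generalize W ^ 2 = w2 at hW e1
    omega
  · have hU2 := sq_emod_eight_of_odd hU
    have hZ2 := sq_emod_eight_of_odd hZ
    obtain ⟨i, hi⟩ : ∃ i, U ^ 2 = 8 * i + 1 := ⟨U ^ 2 / 8, by omega⟩
    obtain ⟨j, hj⟩ : ∃ j, Z ^ 2 = 8 * j + 1 := ⟨Z ^ 2 / 8, by omega⟩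
    obtain ⟨δ, hδ⟩ : ∃ δ, d = 4 * δ + 3 := ⟨d / 4, by omega⟩
    obtain ⟨δ', hδ'⟩ : ∃ δ', d' = 4 * δ' + 3 := ⟨d' / 4, by omega⟩
    obtain ⟨γ, hγ⟩ : ∃ γ, c = 4 * γ + 3 := ⟨c / 4, by omega⟩
    have e1 : W ^ 2 = 16 * (d * (4 * i ^ 2 + i) + c * (8 * i * j + i + j) + d' * (4 * j ^ 2 + j) + k) +
        (d + 2 * c + d') := by
      linear_combination h + d * (U ^ 2 + 8 * i + 1) * hi + 2 * c * Z ^ 2 * hi +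
        2 * c * (8 * i + 1) * hj + d' * (Z ^ 2 + 8 * j + 1) * hj
    subst hδ hδ' hγ
    have e2 : 12 * (δ + δ') = 24 * γ + 16 * (γ ^ 2 - δ * δ' - e) := by linear_combination (-1 : ℤ) * he
    generalize (4 * δ + 3) * (4 * i ^ 2 + i) + (4 * γ + 3) * (8 * i * j + i + j) +
      (4 * δ' + 3) * (4 * j ^ 2 + j) + k = K at e1
    generalize γ ^ 2 - δ * δ' - e = M at e2
    generalize W ^ 2 = w2 at hW e1
    omega

/-- **The local condition at `2`, over `ℤ_2`**: with `d ≡ d' ≡ c ≡ 3 (mod 4)` and `16 ∣ c² - dd'`,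
`W² = d U⁴ + 2c U²Z² + d' Z⁴` has no solution in `ℤ_2` with `U` or `Z` a unit (reduce modulo `16`
via `toZModPow 4` and apply the congruence form). [cite: Zywina2025, Lemma 3.1 (proof)] -/
theorem not_sq_eq_quartic_padicInt_two {d d' c e : ℤ} {U Z W : ℤ_[2]} (hd : d % 4 = 3)
    (hd' : d' % 4 = 3) (hc : c % 4 = 3) (he : c ^ 2 - d * d' = 16 * e)
    (hprim : ¬ (((2 : ℕ) : ℤ_[2]) ∣ U ∧ ((2 : ℕ) : ℤ_[2]) ∣ Z))
    (h : W ^ 2 = d * U ^ 4 + 2 * c * U ^ 2 * Z ^ 2 + d' * Z ^ 4) : False := by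
  set ψ : ℤ_[2] →+* ZMod (2 ^ 4) := PadicInt.toZModPow 4 with hψdef
  -- even residue mod 16 ⇒ divisible by 2
  have hdvd : ∀ X : ℤ_[2], Even ((ψ X).val : ℤ) → ((2 : ℕ) : ℤ_[2]) ∣ X := by
    intro X hX
    obtain ⟨x₁, hx₁⟩ := hX
    have h1 : ψ X = ψ (2 * (x₁ : ℤ_[2])) := by
      rw [map_mul, map_intCast, map_ofNat, ← ZMod.natCast_zmod_val (ψ X)]
      have h2 : (((ψ X).val : ℤ) : ZMod (2 ^ 4)) = ((x₁ + x₁ : ℤ) : ZMod (2 ^ 4)) := by rw [hx₁]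
      push_cast at h2
      rw [h2]; ring
    have h2 : X - 2 * (x₁ : ℤ_[2]) ∈ RingHom.ker ψ := by
      rw [RingHom.mem_ker, map_sub, h1, sub_self]
    rw [hψdef, PadicInt.ker_toZModPow, Ideal.mem_span_singleton] at h2
    obtain ⟨t, ht⟩ := h2
    refine ⟨2 ^ 3 * t + x₁, ?_⟩
    have ht' : X = ((2 : ℕ) : ℤ_[2]) ^ 4 * t + 2 * x₁ := by rw [← ht]; ring
    rw [ht']; push_cast; ring
  set u : ℤ := ((ψ U).val : ℤ) with hu
  set z : ℤ := ((ψ Z).val : ℤ) with hz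
  set w : ℤ := ((ψ W).val : ℤ) with hw
  have hodd : Odd u ∨ Odd z := by
    by_contra hno
    rw [not_or, Int.not_odd_iff_even, Int.not_odd_iff_even] at hno
    exact hprim ⟨hdvd U hno.1, hdvd Z hno.2⟩
  have hU : ψ U = (u : ZMod (2 ^ 4)) := by rw [hu, Int.cast_natCast, ZMod.natCast_zmod_val]
  have hZ : ψ Z = (z : ZMod (2 ^ 4)) := by rw [hz, Int.cast_natCast, ZMod.natCast_zmod_val]
  have hW : ψ W = (w : ZMod (2 ^ 4)) := by rw [hw, Int.cast_natCast, ZMod.natCast_zmod_val]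
  have hψ := congrArg ψ h
  simp only [map_pow, map_mul, map_add, map_intCast, map_ofNat, hU, hZ, hW] at hψ
  have hX : (((w ^ 2 - (d * u ^ 4 + 2 * c * u ^ 2 * z ^ 2 + d' * z ^ 4) : ℤ)) : ZMod (2 ^ 4)) = 0 := by
    push_cast; rw [hψ]; ring
  rw [ZMod.intCast_zmod_eq_zero_iff_dvd] at hX
  obtain ⟨k, hk⟩ := hX
  push_cast at hk
  exact not_sq_eq_quartic_mod_sixteen hd hd' hc he hodd (k := k) (W := w) (by linear_combination hk)

/-- **The local condition at `2`, `2`-adically**: with `a = 2c`, `d ≡ d' ≡ c ≡ 3 (mod 4)` and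
`16 ∣ c² - dd'`, the curve `w² = d u⁴ + a u²z² + d' z⁴` has no non-trivial `ℚ_2`-point.
[cite: Zywina2025, Lemma 3.1 (proof)] -/
theorem not_isSoluble_two_of_mod_four {a d d' c e : ℤ} (ha : a = 2 * c) (hd : d % 4 = 3)
    (hd' : d' % 4 = 3) (hc : c % 4 = 3) (he : c ^ 2 - d * d' = 16 * e) :
    ¬ ((twoIsogenyQuartic a d d').map (Int.castRingHom ℚ_[2])).IsSoluble := by
  intro h
  subst ha
  have h1 : ¬ ((2 : ℕ) : ℤ_[2]) ∣ 1 := PadicInt.prime_p.not_dvd_one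
  obtain ⟨e₁, e₁', hee, t, s, hs⟩ := exists_padicInt_of_isSoluble h
  push_cast at hs
  rcases hee with ⟨rfl, rfl⟩ | ⟨rfl, rfl⟩
  · exact not_sq_eq_quartic_padicInt_two hd hd' hc he (U := 1) (Z := t) (W := s)
      (fun hh => h1 hh.1) (by rw [hs]; ring)
  · exact not_sq_eq_quartic_padicInt_two hd hd' hc he (U := t) (Z := 1) (W := s)
      (fun hh => h1 hh.2) (by rw [hs]; ring)

end LocalPadic

namespace ZywinaParams

variable {m n q r : ℕ} (P : ZywinaParams m n q r)
include P

/-! ### `S(-5q, 4qr) = {1, q, r, qr}` (Lemma 3.2 with 3.3) -/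

/-- **Zywina's Lemma 3.2**: the Selmer set `S^{(φ̂)}(E'/ℚ) = S(-5q, 4qr)` of squarefree `d ∣ 4qr`
with `w² = d u⁴ - 5q u²z² + (4qr/d) z⁴` everywhere locally soluble is contained in `{1, q, r, qr}`:
`d > 0` by the real place, `d` odd by the place `m` (`(2/m) = -1`, `(q/m) = (r/m) = 1`, and a
`ℚ_m`-point forces `(d/m) = 1` since `m ∥ a² - 4b = 9mq`). [cite: Zywina2025, Lemma 3.2] -/
theorem mem_of_mem_twoIsogenySelmerGroup {d : ℤ}
    (hd : d ∈ twoIsogenySelmerGroup (-5 * q) (4 * q * r)) :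
    d ∈ ({1, (q : ℤ), (r : ℤ), (q : ℤ) * r} : Finset ℤ) := by
  haveI : Fact m.Prime := ⟨P.m_prime⟩
  have hab := P.hab
  have hb : (4 * q * r : ℤ) ≠ 0 := left_ne_zero_of_mul hab
  have hm0 := P.m_pos_int; have hq0 := P.q_pos_int; have hr0 := P.r_pos_int
  rw [mem_twoIsogenySelmerGroup_iff hb] at hd
  obtain ⟨hsqf, hdvd, hloc⟩ := hd
  obtain ⟨d', hdd'⟩ := hdvd
  have hd'eq : (4 * q * r : ℤ) / d = d' := by
    rw [hdd', Int.mul_ediv_cancel_left _ hsqf.ne_zero]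
  rw [hd'eq] at hloc
  obtain ⟨hreal, hpadic⟩ := hloc
  -- `d > 0` (the real place)
  have hd : 0 < d := by
    rcases lt_or_gt_of_ne hsqf.ne_zero with hneg | hpos
    · exfalso
      have hd' : d' < 0 := by nlinarith
      exact not_isSoluble_real_twoIsogenyQuartic_of_neg hneg hd' (by nlinarith) hreal
    · exact hpos
  -- `(d/m) = 1` (the place `m`)
  have hleg : legendreSym m d = 1 := by
    have hmpp : Prime (m : ℤ) := Nat.prime_iff_prime_int.mp P.m_prime
    have hmd : ¬ (m : ℤ) ∣ d := by
      intro h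
      have h' : (m : ℤ) ∣ 4 * q * r := h.trans ⟨d', hdd'⟩
      rw [show (4 : ℤ) * q * r = 4 * ((q : ℤ) * r) by ring] at h'
      rcases hmpp.dvd_or_dvd h' with h1 | h1
      · exact P.not_m_dvd_small (k := 4) (by norm_num) (by norm_num) (Int.natCast_dvd_natCast.mp h1)
      · rcases hmpp.dvd_or_dvd h1 with h2 | h2
        · exact P.m_ne_q ((Nat.prime_dvd_prime_iff_eq P.m_prime P.q_prime).mp (Int.natCast_dvd_natCast.mp h2))
        · exact P.m_ne_r ((Nat.prime_dvd_prime_iff_eq P.m_prime P.r_prime).mp (Int.natCast_dvd_natCast.mp h2))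
    have hB : (-5 * (q : ℤ)) ^ 2 - 4 * d * d' = 9 * m * q := by
      have hq := P.q_eq_int; have hr := P.r_eq_int
      linear_combination 4 * hdd' + 25 * (q : ℤ) * hq - 16 * (q : ℤ) * hr
    have h1 : (m : ℤ) ∣ (-5 * (q : ℤ)) ^ 2 - 4 * d * d' := by rw [hB]; exact ⟨9 * q, by ring⟩
    have h2 : ¬ (m : ℤ) ^ 2 ∣ (-5 * (q : ℤ)) ^ 2 - 4 * d * d' := by
      rw [hB, pow_two, show (9 : ℤ) * m * q = m * (9 * q) by ring]
      intro h
      have h' : (m : ℤ) ∣ 9 * q := (mul_dvd_mul_iff_left hm0.ne').mp h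
      rw [show (9 : ℤ) * q = 3 * (3 * (q : ℤ)) by ring] at h'
      rcases hmpp.dvd_or_dvd h' with h3 | h3
      · exact P.not_m_dvd_small (k := 3) (by norm_num) (by norm_num) (Int.natCast_dvd_natCast.mp h3)
      rcases hmpp.dvd_or_dvd h3 with h4 | h4
      · exact P.not_m_dvd_small (k := 3) (by norm_num) (by norm_num) (Int.natCast_dvd_natCast.mp h4)
      · exact P.m_ne_q ((Nat.prime_dvd_prime_iff_eq P.m_prime P.q_prime).mp (Int.natCast_dvd_natCast.mp h4))
    have hm2 : m ≠ 2 := by have := P.eleven_le; omega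
    obtain ⟨hd0, hsq⟩ := isSquare_zmod_of_isSoluble_padic hm2 hmd h1 h2 (hpadic m)
    exact (legendreSym.eq_one_iff m hd0).mpr hsq
  -- positive divisors of `qr` have symbol `1`
  have key : ∀ e : ℤ, e ∣ (q : ℤ) * r → 0 < e → legendreSym m e = 1 := by
    intro e he hepos
    rcases eq_of_dvd_prime_mul_prime P.q_prime P.r_prime he with
      rfl | rfl | rfl | rfl | rfl | rfl | rfl | rfl
    · exact legendreSym_one'
    · norm_num at hepos
    · exact P.legendreSym_m_q
    · linarith
    · exact P.legendreSym_m_r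
    · linarith
    · rw [legendreSym.mul, P.legendreSym_m_q, P.legendreSym_m_r]; norm_num
    · nlinarith
  -- `d ∣ 2qr` (squarefree), then `d ∣ qr` or `d = 2 d₁`
  have h4 : d ∣ ((2 : ℕ) : ℤ) * (((2 : ℕ) : ℤ) * ((q : ℤ) * r)) :=
    ⟨d', by rw [← hdd']; push_cast; ring⟩
  have h2 := dvd_of_squarefree_of_dvd_prime_sq_mul Nat.prime_two hsqf h4
  rcases dvd_prime_mul Nat.prime_two h2 with h3 | ⟨d₁, rfl, h3⟩
  · rcases eq_of_dvd_prime_mul_prime P.q_prime P.r_prime h3 with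
      rfl | rfl | rfl | rfl | rfl | rfl | rfl | rfl
    · simp
    · norm_num at hd
    · simp
    · linarith
    · simp
    · linarith
    · simp
    · nlinarith
  · exfalso
    push_cast at hd hleg
    have hd₁ : 0 < d₁ := by linarith
    have h5 := key d₁ h3 hd₁
    rw [legendreSym.mul, P.legendreSym_m_two, h5] at hleg
    norm_num at hleg

/-- **`S^{(φ̂)}(E'/ℚ) = {1, q, r, qr}`** (Zywina, Lemmas 3.2 and 3.3 (ii)): the tree's explicit Selmer set
`twoIsogenySelmerGroup (-5q) (4qr)` is exactly `{1, q, r, qr}` — the upper bound is the previous lemma,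
and each of the four classes is the image of a rational point (`range_xSqClass_eq`), hence everywhere
locally soluble. [cite: Zywina2025, Lemma 3.3] -/
theorem twoIsogenySelmerGroup_eq :
    twoIsogenySelmerGroup (-5 * q) (4 * q * r) = {1, (q : ℤ), (r : ℤ), (q : ℤ) * r} := by
  have hab := P.hab
  ext d
  refine ⟨P.mem_of_mem_twoIsogenySelmerGroup, fun hd => ?_⟩
  have hsq : Squarefree d := by
    simp only [Finset.mem_insert, Finset.mem_singleton] at hd
    rcases hd with rfl | rfl | rfl | rfl
    · exact squarefree_one
    · exact squarefree_intCast_of_prime P.q_prime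
    · exact squarefree_intCast_of_prime P.r_prime
    · exact squarefree_intCast_mul_of_prime P.q_prime P.r_prime P.q_ne_r
  have hc : sqClass (d : ℚ) ∈
      Set.range (⟨0, ((-5 * q : ℤ) : ℚ), 0, ((4 * q * r : ℤ) : ℚ), 0⟩ : WeierstrassCurve ℚ).xSqClass := by
    rw [P.range_xSqClass_eq]
    exact Finset.mem_coe.mpr (Finset.mem_image_of_mem _ hd)
  obtain ⟨d₂, hd₂, he⟩ := Finset.mem_image.mp (Finset.mem_coe.mp
    (range_xSqClass_subset_image_twoIsogenySelmerGroup hab hc))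
  rwa [← eq_of_sqClass_intCast_eq (squarefree_of_mem_twoIsogenySelmerGroup hd₂) hsq he]

/-! ### `S(10q, 9mq) = {1, -m, -q, mq}` (Lemma 3.1 with 3.3) -/

/-- **Zywina's Lemma 3.1**: the Selmer set `S^{(φ)}(E/ℚ) = S(10q, 9mq)` of squarefree `d ∣ 9mq` with
`w² = d u⁴ + 10q u²z² + (9mq/d) z⁴` everywhere locally soluble is contained in `{1, -m, -q, mq}`:
a `ℚ_r`-point forces `(d/r) = 1` (`r ∥ 100q² - 36mq = 64qr`; `(-1/r) = -1`, `(3/r) = 1`,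
`(m/r) = (q/r) = -1`), and a `ℚ₂`-point forces `d ≡ 1 (mod 4)` (for `d ≡ 3 (mod 4)` also
`9mq/d ≡ 3 (mod 4)`, `5q ≡ 3 (mod 4)`, `25q² - 9mq = 16qr`). [cite: Zywina2025, Lemma 3.1] -/
theorem mem_of_mem_twoIsogenySelmerGroup' {d : ℤ}
    (hd : d ∈ twoIsogenySelmerGroup (10 * q) (9 * m * q)) :
    d ∈ ({1, -(m : ℤ), -(q : ℤ), (m : ℤ) * q} : Finset ℤ) := by
  haveI : Fact r.Prime := ⟨P.r_prime⟩
  have hab := P.hab'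
  have hb : (9 * m * q : ℤ) ≠ 0 := left_ne_zero_of_mul hab
  have hm0 := P.m_pos_int; have hq0 := P.q_pos_int; have hr0 := P.r_pos_int
  have hm4 : (m : ℤ) % 4 = 3 := by have := P.m_mod; omega
  have hq4 : (q : ℤ) % 4 = 3 := by have := P.q_mod; omega
  rw [mem_twoIsogenySelmerGroup_iff hb] at hd
  obtain ⟨hsqf, hdvd, hloc⟩ := hd
  obtain ⟨d', hdd'⟩ := hdvd
  have hd'eq : (9 * m * q : ℤ) / d = d' := by
    rw [hdd', Int.mul_ediv_cancel_left _ hsqf.ne_zero]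
  rw [hd'eq] at hloc
  obtain ⟨-, hpadic⟩ := hloc
  -- `d` is odd
  have hmq4 : ((m : ℤ) * q) % 4 = 1 := by
    rw [Int.mul_emod, hm4, hq4]; norm_num
  have hdodd : d % 2 = 1 := by
    have hodd : Odd (9 * (m : ℤ) * q) := by
      rw [Int.odd_mul, Int.odd_mul]
      exact ⟨⟨by decide, by rw [Int.odd_iff]; omega⟩, by rw [Int.odd_iff]; omega⟩
    rw [hdd'] at hodd
    exact Int.odd_iff.mp (Int.odd_mul.mp hodd).1
  -- `d ≡ 1 (mod 4)` (the place `2`)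
  have hd4 : d % 4 = 1 := by
    by_contra hne
    have hd3 : d % 4 = 3 := by omega
    have hd'3 : d' % 4 = 3 := by
      have h1 : (d * d') % 4 = 1 := by
        rw [← hdd', show (9 : ℤ) * m * q = 9 * ((m : ℤ) * q) by ring, Int.mul_emod, hmq4]; norm_num
      rw [Int.mul_emod, hd3] at h1
      omega
    have he : (5 * (q : ℤ)) ^ 2 - d * d' = 16 * ((q : ℤ) * r) := by
      have hq := P.q_eq_int; have hr := P.r_eq_int
      linear_combination hdd' + 25 * (q : ℤ) * hq - 16 * (q : ℤ) * hr
    exact not_isSoluble_two_of_mod_four (a := 10 * q) (by ring) hd3 hd'3 (by omega) he (hpadic 2)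
  -- `(d/r) = 1` (the place `r`)
  have hleg : legendreSym r d = 1 := by
    have hrpp : Prime (r : ℤ) := Nat.prime_iff_prime_int.mp P.r_prime
    have hrd : ¬ (r : ℤ) ∣ d := by
      intro h
      have h' : (r : ℤ) ∣ 9 * m * q := h.trans ⟨d', hdd'⟩
      rw [show (9 : ℤ) * m * q = 9 * ((m : ℤ) * q) by ring] at h'
      rcases hrpp.dvd_or_dvd h' with h1 | h1
      · exact P.not_r_dvd_small (k := 9) (by norm_num) (by norm_num) (Int.natCast_dvd_natCast.mp h1)
      · rcases hrpp.dvd_or_dvd h1 with h2 | h2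
        · exact P.m_ne_r ((Nat.prime_dvd_prime_iff_eq P.r_prime P.m_prime).mp (Int.natCast_dvd_natCast.mp h2)).symm
        · exact P.q_ne_r ((Nat.prime_dvd_prime_iff_eq P.r_prime P.q_prime).mp (Int.natCast_dvd_natCast.mp h2)).symm
    have hB : (10 * (q : ℤ)) ^ 2 - 4 * d * d' = 64 * q * r := by
      have hq := P.q_eq_int; have hr := P.r_eq_int
      linear_combination 4 * hdd' + 100 * (q : ℤ) * hq - 64 * (q : ℤ) * hr
    have h1 : (r : ℤ) ∣ (10 * (q : ℤ)) ^ 2 - 4 * d * d' := by rw [hB]; exact ⟨64 * q, by ring⟩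
    have h2 : ¬ (r : ℤ) ^ 2 ∣ (10 * (q : ℤ)) ^ 2 - 4 * d * d' := by
      rw [hB, pow_two, show (64 : ℤ) * q * r = r * (2 ^ 6 * q) by ring]
      intro h
      have h' : (r : ℤ) ∣ 2 ^ 6 * q := (mul_dvd_mul_iff_left hr0.ne').mp h
      rcases hrpp.dvd_or_dvd h' with h3 | h3
      · have h5 : (r : ℤ) ∣ 2 := hrpp.dvd_of_dvd_pow h3
        exact P.not_r_dvd_small (k := 2) (by norm_num) (by norm_num) (Int.natCast_dvd_natCast.mp h5)
      · exact P.q_ne_r ((Nat.prime_dvd_prime_iff_eq P.r_prime P.q_prime).mp (Int.natCast_dvd_natCast.mp h3)).symm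
    have hr2 : r ≠ 2 := by have := P.eleven_le; have := P.m_lt_q; have := P.q_lt_r; omega
    obtain ⟨hd0, hsq⟩ := isSquare_zmod_of_isSoluble_padic hr2 hrd h1 h2 (hpadic r)
    exact (legendreSym.eq_one_iff r hd0).mpr hsq
  -- `d ∣ 3mq` (squarefree), then `d ∣ mq` or `d = 3 d₁`
  have h9 : d ∣ ((3 : ℕ) : ℤ) * (((3 : ℕ) : ℤ) * ((m : ℤ) * q)) :=
    ⟨d', by rw [← hdd']; push_cast; ring⟩
  have h3 := dvd_of_squarefree_of_dvd_prime_sq_mul Nat.prime_three hsqf h9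
  rcases dvd_prime_mul Nat.prime_three h3 with h5 | ⟨d₁, rfl, h5⟩
  · rcases eq_of_dvd_prime_mul_prime P.m_prime P.q_prime h5 with
      rfl | rfl | rfl | rfl | rfl | rfl | rfl | rfl
    · simp
    · omega
    · omega
    · simp
    · omega
    · simp
    · simp
    · omega
  · exfalso
    push_cast at hd4 hleg hdodd
    rw [legendreSym.mul, P.legendreSym_r_three, one_mul] at hleg
    rcases eq_of_dvd_prime_mul_prime P.m_prime P.q_prime h5 with
      rfl | rfl | rfl | rfl | rfl | rfl | rfl | rfl
    · omega
    · rw [P.legendreSym_r_neg_one] at hleg; norm_num at hleg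
    · rw [P.legendreSym_r_m] at hleg; norm_num at hleg
    · omega
    · rw [P.legendreSym_r_q] at hleg; norm_num at hleg
    · omega
    · omega
    · rw [show -((m : ℤ) * q) = (-1) * m * q by ring, legendreSym.mul, legendreSym.mul,
        P.legendreSym_r_neg_one, P.legendreSym_r_m, P.legendreSym_r_q] at hleg
      norm_num at hleg

/-- **`S^{(φ)}(E/ℚ) = {1, -m, -q, mq}`** (Zywina, Lemmas 3.1 and 3.3 (i)): the tree's explicit Selmer
set `twoIsogenySelmerGroup (10q) (9mq)` (`= twoIsogenySelmerGroup' (-5q) (4qr)`, the Selmer group of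
`φ : E → E'`) is exactly `{1, -m, -q, mq}`. [cite: Zywina2025, Lemma 3.3] -/
theorem twoIsogenySelmerGroup_eq' :
    twoIsogenySelmerGroup (10 * q) (9 * m * q) = {1, -(m : ℤ), -(q : ℤ), (m : ℤ) * q} := by
  have hab := P.hab'
  ext d
  refine ⟨P.mem_of_mem_twoIsogenySelmerGroup', fun hd => ?_⟩
  have hsq : Squarefree d := by
    simp only [Finset.mem_insert, Finset.mem_singleton] at hd
    rcases hd with rfl | rfl | rfl | rfl
    · exact squarefree_one
    · exact squarefree_neg_intCast_of_prime P.m_prime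
    · exact squarefree_neg_intCast_of_prime P.q_prime
    · exact squarefree_intCast_mul_of_prime P.m_prime P.q_prime P.m_ne_q
  have hc : sqClass (d : ℚ) ∈
      Set.range (⟨0, ((10 * q : ℤ) : ℚ), 0, ((9 * m * q : ℤ) : ℚ), 0⟩ : WeierstrassCurve ℚ).xSqClass := by
    rw [P.range_xSqClass_eq']
    exact Finset.mem_coe.mpr (Finset.mem_image_of_mem _ hd)
  obtain ⟨d₂, hd₂, he⟩ := Finset.mem_image.mp (Finset.mem_coe.mp
    (range_xSqClass_subset_image_twoIsogenySelmerGroup hab hc))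
  rwa [← eq_of_sqClass_intCast_eq (squarefree_of_mem_twoIsogenySelmerGroup hd₂) hsq he]

/-- `S' (-5q, 4qr) = S(10q, 9mq)`: the primed Selmer set of `E_{-5q,4qr}` is the set just computed
(`(-2)(-5q) = 10q`, `25q² - 16qr = 9mq`). [cite: Zywina2025, §3] -/
theorem twoIsogenySelmerGroup'_eq_selmer :
    twoIsogenySelmerGroup' (-5 * q) (4 * q * r) = {1, -(m : ℤ), -(q : ℤ), (m : ℤ) * q} := by
  rw [twoIsogenySelmerGroup'_eq, P.disc_eq, show -2 * (-5 * (q : ℤ)) = 10 * q by ring]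
  exact P.twoIsogenySelmerGroup_eq'

/-- `#{1, q, r, qr} = 4`. [folklore] -/
private theorem card_selmer : (({1, (q : ℤ), (r : ℤ), (q : ℤ) * r} : Finset ℤ)).card = 4 := by
  have hq1 : (1 : ℤ) < q := by exact_mod_cast P.q_prime.one_lt
  have hr1 : (1 : ℤ) < r := by exact_mod_cast P.r_prime.one_lt
  have hqr : (q : ℤ) ≠ r := by exact_mod_cast P.q_ne_r
  rw [Finset.card_insert_of_notMem, Finset.card_insert_of_notMem, Finset.card_pair]
  · nlinarith
  · simp only [Finset.mem_insert, Finset.mem_singleton, not_or]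
    exact ⟨hqr, by nlinarith⟩
  · simp only [Finset.mem_insert, Finset.mem_singleton, not_or]
    exact ⟨by omega, by omega, by nlinarith⟩

/-- `#{1, -m, -q, mq} = 4`. [folklore] -/
private theorem card_selmer' : (({1, -(m : ℤ), -(q : ℤ), (m : ℤ) * q} : Finset ℤ)).card = 4 := by
  have hm1 : (1 : ℤ) < m := by exact_mod_cast P.m_prime.one_lt
  have hq1 : (1 : ℤ) < q := by exact_mod_cast P.q_prime.one_lt
  have hmq : (m : ℤ) ≠ q := by exact_mod_cast P.m_ne_q
  rw [Finset.card_insert_of_notMem, Finset.card_insert_of_notMem, Finset.card_pair]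
  · nlinarith
  · simp only [Finset.mem_insert, Finset.mem_singleton, not_or]
    exact ⟨by omega, by nlinarith⟩
  · simp only [Finset.mem_insert, Finset.mem_singleton, not_or]
    exact ⟨by omega, by omega, by nlinarith⟩

/-- **`dim₂ S^{(φ̂)}(E'/ℚ) = 2`** (`#S(-5q, 4qr) = 4 = 2²`). [cite: Zywina2025, Lemma 3.3] -/
theorem twoIsogenySelmerRank_eq : twoIsogenySelmerRank (-5 * q) (4 * q * r) = 2 := by
  have h := two_pow_twoIsogenySelmerRank_eq_card P.hab
  rw [P.twoIsogenySelmerGroup_eq, P.card_selmer, show (4 : ℕ) = 2 ^ 2 by norm_num] at h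
  exact Nat.pow_right_injective le_rfl h

/-- **`dim₂ S^{(φ)}(E/ℚ) = 2`** (`#S'(-5q, 4qr) = #S(10q, 9mq) = 4 = 2²`). [cite: Zywina2025, Lemma 3.3] -/
theorem twoIsogenySelmerRank'_eq : twoIsogenySelmerRank' (-5 * q) (4 * q * r) = 2 := by
  have h := two_pow_twoIsogenySelmerRank'_eq_card P.hab
  rw [P.twoIsogenySelmerGroup'_eq_selmer, P.card_selmer', show (4 : ℕ) = 2 ^ 2 by norm_num] at h
  exact Nat.pow_right_injective le_rfl h

/-- **`Ш(E/ℚ)[φ] = 0`** for `E = E_{-5q,4qr}` and its `2`-isogeny `φ` with kernel `{O, (0,0)}`, in the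
tree's form: the classes of the homogeneous spaces `C_d` (`im Ξ`, `Ξ : ℚ*/ℚ*² → H¹(ℚ, E)`) meet
`Ш(E/ℚ)` trivially. From `2^{dim S'} = #α(E'(ℚ)) · #(Ш(E) ∩ im Ξ)` (Silverman X.4.2(a), tree
`two_pow_twoIsogenySelmerRank'_eq_natCard_mul`) with `dim S' = 2` and `#α(E'(ℚ)) = 4`: Zywina's
"the images equal the Selmer groups" (Lemma 3.3), equivalently `Ш(E)[φ] = 0`.
[cite: Zywina2025, Lemma 3.3] [cite: SilvermanAEC2009, Thm. X.4.2(a)] -/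
theorem sha_inf_range_twoIsogenyTorsorHom_eq_bot
    [hE : (⟨0, ((-5 * q : ℤ) : ℚ), 0, ((4 * q * r : ℤ) : ℚ), 0⟩ : WeierstrassCurve ℚ).IsElliptic] :
    (⟨0, ((-5 * q : ℤ) : ℚ), 0, ((4 * q * r : ℤ) : ℚ), 0⟩ : WeierstrassCurve ℚ).sha ⊓
      (⟨0, ((-5 * q : ℤ) : ℚ), 0, ((4 * q * r : ℤ) : ℚ), 0⟩ : WeierstrassCurve ℚ).twoIsogenyTorsorHom.range
        = ⊥ := by
  have hab := P.hab
  have key := two_pow_twoIsogenySelmerRank'_eq_natCard_mul hab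
  rw [← twoIsogenyCodomain_mk_intCast, P.twoIsogenyCodomain_eq, P.range_xSqClass_eq',
    Nat.card_coe_set_eq, Set.ncard_coe_finset, P.card_four', P.twoIsogenySelmerRank'_eq] at key
  exact AddSubgroup.eq_bot_of_card_eq _ (by omega)

/-- **`Ш(E'/ℚ)[φ̂] = 0`**, in the tree's form for the model `V₀ : y² = x³ + (5q/2) x² + (9mq/16) x` of
`E'` (the curve with `V₀.twoIsogenyCodomain = E_{-5q,4qr}` literally): `Ш(V₀/ℚ) ∩ im Ξ = ⊥`, from
`2^{dim S} = #α(E(ℚ)) · #(Ш(V₀) ∩ im Ξ)` (tree `two_pow_twoIsogenySelmerRank_eq_natCard_mul_halfModel`)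
with `dim S = 2`, `#α(E(ℚ)) = 4`. [cite: Zywina2025, Lemma 3.3] [cite: SilvermanAEC2009, Thm. X.4.2(a)] -/
theorem sha_inf_range_twoIsogenyTorsorHom_eq_bot_halfModel
    [hV₀ : (⟨0, -((-5 * q : ℤ) : ℚ) / 2, 0, (((-5 * q : ℤ) : ℚ) ^ 2 - 4 * ((4 * q * r : ℤ) : ℚ)) / 16, 0⟩ :
      WeierstrassCurve ℚ).IsElliptic] :
    (⟨0, -((-5 * q : ℤ) : ℚ) / 2, 0, (((-5 * q : ℤ) : ℚ) ^ 2 - 4 * ((4 * q * r : ℤ) : ℚ)) / 16, 0⟩ :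
        WeierstrassCurve ℚ).sha ⊓
      (⟨0, -((-5 * q : ℤ) : ℚ) / 2, 0, (((-5 * q : ℤ) : ℚ) ^ 2 - 4 * ((4 * q * r : ℤ) : ℚ)) / 16, 0⟩ :
        WeierstrassCurve ℚ).twoIsogenyTorsorHom.range = ⊥ := by
  have hab := P.hab
  have key := two_pow_twoIsogenySelmerRank_eq_natCard_mul_halfModel hab
  rw [P.range_xSqClass_eq, Nat.card_coe_set_eq, Set.ncard_coe_finset, P.card_four,
    P.twoIsogenySelmerRank_eq] at key
  exact AddSubgroup.eq_bot_of_card_eq _ (by omega)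

end ZywinaParams

/-! ### For the family as stated -/

/-- `E_{m,n}` is in two-torsion normal form `y² = x³ + ax² + bx` (`a₁ = a₃ = a₆ = 0`). [cite: Zywina2025, Thm 1.2] -/
instance isTwoTorsionNF_zywinaCurve (m n : ℕ) : (zywinaCurve m n).IsTwoTorsionNF := ⟨rfl, rfl, rfl⟩

/-- **Zywina 2025, Lemma 3.3 with 3.1/3.2, for `E_{m,n}`** (admissible `(m, n)`, `q = m + 16n²`,
`r = m + 25n²`): the two isogeny-Selmer sets are `S(-5q, 4qr) = {1, q, r, qr}` (`= S^{(φ̂)}(E'/ℚ)`) and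
`S'(-5q, 4qr) = S(10q, 9mq) = {1, -m, -q, mq}` (`= S^{(φ)}(E/ℚ)`); both have `𝔽₂`-dimension `2`.
[cite: Zywina2025, Lemma 3.3] -/
theorem twoIsogenySelmerGroup_zywinaCurve {m n : ℕ} (h : ZywinaAdmissible m n) :
    twoIsogenySelmerGroup (-5 * ((m + 16 * n ^ 2 : ℕ) : ℤ))
        (4 * ((m + 16 * n ^ 2 : ℕ) : ℤ) * ((m + 25 * n ^ 2 : ℕ) : ℤ)) =
      {1, ((m + 16 * n ^ 2 : ℕ) : ℤ), ((m + 25 * n ^ 2 : ℕ) : ℤ),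
        ((m + 16 * n ^ 2 : ℕ) : ℤ) * ((m + 25 * n ^ 2 : ℕ) : ℤ)} ∧
    twoIsogenySelmerGroup' (-5 * ((m + 16 * n ^ 2 : ℕ) : ℤ))
        (4 * ((m + 16 * n ^ 2 : ℕ) : ℤ) * ((m + 25 * n ^ 2 : ℕ) : ℤ)) =
      {1, -(m : ℤ), -((m + 16 * n ^ 2 : ℕ) : ℤ), (m : ℤ) * ((m + 16 * n ^ 2 : ℕ) : ℤ)} ∧
    twoIsogenySelmerRank (-5 * ((m + 16 * n ^ 2 : ℕ) : ℤ))
        (4 * ((m + 16 * n ^ 2 : ℕ) : ℤ) * ((m + 25 * n ^ 2 : ℕ) : ℤ)) = 2 ∧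
    twoIsogenySelmerRank' (-5 * ((m + 16 * n ^ 2 : ℕ) : ℤ))
        (4 * ((m + 16 * n ^ 2 : ℕ) : ℤ) * ((m + 25 * n ^ 2 : ℕ) : ℤ)) = 2 :=
  ⟨h.params.twoIsogenySelmerGroup_eq, h.params.twoIsogenySelmerGroup'_eq_selmer,
    h.params.twoIsogenySelmerRank_eq, h.params.twoIsogenySelmerRank'_eq⟩

/-- **`Ш(E_{m,n}/ℚ)[φ] = 0`** for Zywina's curve and its `2`-isogeny `φ` with kernel `{O, (0,0)}`:
`Ш(E_{m,n}/ℚ) ∩ im Ξ = ⊥` (`Ξ : ℚ*/ℚ*² = H¹(ℚ, E[φ]) → H¹(ℚ, E)`), i.e. every homogeneous space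
`C_d` of `φ` that is everywhere locally soluble has a rational point — Zywina's Lemma 3.3
("`δ(E'(ℚ)) = Sel_φ(E/ℚ)`") in the language of `Ш`. [cite: Zywina2025, Lemma 3.3]
[cite: SilvermanAEC2009, Thm. X.4.2(a)] -/
theorem sha_inf_range_twoIsogenyTorsorHom_zywinaCurve {m n : ℕ} (h : ZywinaAdmissible m n)
    [hE : (zywinaCurve m n).IsElliptic] :
    (zywinaCurve m n).sha ⊓ (zywinaCurve m n).twoIsogenyTorsorHom.range = ⊥ := by
  -- transport along `zywinaCurve_eq` (the instances are propositions)
  have transfer : ∀ {W₁ W₂ : WeierstrassCurve ℚ} (_ : W₁ = W₂) [W₁.IsTwoTorsionNF] [W₁.IsElliptic]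
      [W₂.IsTwoTorsionNF] [W₂.IsElliptic],
      W₂.sha ⊓ W₂.twoIsogenyTorsorHom.range = ⊥ → W₁.sha ⊓ W₁.twoIsogenyTorsorHom.range = ⊥ := by
    intro W₁ W₂ h _ _ _ _ h₂
    subst h
    exact h₂
  haveI := isElliptic_mk_of_ne_zero (F := ℚ) h.params.hab
  exact transfer (zywinaCurve_eq m n) h.params.sha_inf_range_twoIsogenyTorsorHom_eq_bot


end Literature.NumberTheory.EllipticCurves.Zywina2025

end

/-!
## Appendix D (2026-08-25, cell bsd-rank2): `Ш(E_{m,n}/ℚ)[2] = 0`, `corank_{ℤ₂} Sel_{2^∞}(E_{m,n}/ℚ) = 2`,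
## and the root number `W(E_{m,n}) = +1` from `2`-parity

Zywina, §1 (after Theorem 1.2): "For the elliptic curves `E/ℚ` we are considering, we are fortunate to
always have `Ш(E/ℚ)[2] = 0`." In the tree this is Appendix C — `Ш(E)[φ] = 0`
(`ZywinaParams.sha_inf_range_twoIsogenyTorsorHom_eq_bot`) and `Ш(E')[φ̂] = 0` on the half-model of `E'`
(`ZywinaParams.sha_inf_range_twoIsogenyTorsorHom_eq_bot_halfModel`), i.e. Lemma 3.3 — combined with the
functoriality lemma `φ̂_* ∘ φ_* = 2` of `TwoIsogenyShaTwoTorsion.lean`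
(`forall_mem_sha_two_smul_eq_zero_of_halfModel`). Consequences, all PROVED: `#Sel^(2)(E_{m,n}/ℚ) = 2³`
(the tree's exact descent count `natCard_selmerGroup_eq` with `rank = 2`, `#E(ℚ)[2] = 2`, `Ш[2] = 0`;
Zywina's Lemma 3.5 `E(ℚ)/2E(ℚ) ≅ (ℤ/2ℤ)³` read through `0 → E/2E → Sel^(2) → Ш[2] → 0`), `Ш(E_{m,n}/ℚ)[2^∞] = ⊥`,
`corank_{ℤ₂} Ш(E_{m,n}/ℚ)[2^∞] = 0`, hence `corank_{ℤ₂} Sel_{2^∞}(E_{m,n}/ℚ) = rank E_{m,n}(ℚ) = 2` by the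
tree's corank identity (`selmerCorank_eq_mordellWeilRank_add_holds`, proved); and — granted the `2`-parity
theorem (Monsky 1996; Dokchitser–Dokchitser 2010, Thm. 1.4 with Cor. 4.20: the tree's named fact
`p_parity W 2`, `(-1)^{corank Sel_{2^∞}} = w(E)`) — the global root number `W(E_{m,n}) = (-1)² = +1`, the
value Zywina asserts in §1.1 (there from local root numbers, `W = W₂W₃(−1)^{(m+1)/2}`, `W₂ = W₃ = 1`,
stated without proof). This removes the family hypothesis "`W(E_{m,n}) = +1`" of the cell's typed
chain in favour of the single existing fact `p_parity · 2`. Nothing in this appendix concerns the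
analytic rank.
-/

noncomputable section

open scoped Classical

open _root_.WeierstrassCurve

namespace Literature.NumberTheory.EllipticCurves.Zywina2025

namespace ZywinaParams

variable {m n q r : ℕ} (P : ZywinaParams m n q r)
include P

/-- **`Ш(E/ℚ)[2] = 0` for `E = E_{-5q,4qr}`** (Zywina, §1: "we are fortunate to always have
`Ш(E/ℚ)[2] = 0`"): every class of `Ш(E/ℚ)` killed by `2` is trivial — from `Ш(E)[φ] = 0` and
`Ш(E')[φ̂] = 0` (Appendix C, Lemma 3.3) and `φ̂ ∘ φ = [2]`
(`forall_mem_sha_two_smul_eq_zero_of_halfModel`). [cite: Zywina2025, §1 (remark after Thm 1.2) and Lemma 3.3] -/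
theorem forall_mem_sha_two_smul_eq_zero
    [hE : (⟨0, ((-5 * q : ℤ) : ℚ), 0, ((4 * q * r : ℤ) : ℚ), 0⟩ : WeierstrassCurve ℚ).IsElliptic] :
    ∀ c ∈ (⟨0, ((-5 * q : ℤ) : ℚ), 0, ((4 * q * r : ℤ) : ℚ), 0⟩ : WeierstrassCurve ℚ).sha,
      2 • c = 0 → c = 0 := by
  haveI := isElliptic_halfModel P.hab
  exact forall_mem_sha_two_smul_eq_zero_of_halfModel P.sha_inf_range_twoIsogenyTorsorHom_eq_bot_halfModel
    P.sha_inf_range_twoIsogenyTorsorHom_eq_bot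

end ZywinaParams

/-- **`Ш(E_{m,n}/ℚ)[2] = 0`** for Zywina's curve (admissible `(m, n)`): every class of `Ш(E_{m,n}/ℚ)`
killed by `2` is trivial. [cite: Zywina2025, §1 (remark after Thm 1.2) and Lemma 3.3] -/
theorem forall_mem_sha_two_smul_eq_zero_zywinaCurve {m n : ℕ} (h : ZywinaAdmissible m n) :
    ∀ c ∈ (zywinaCurve m n).sha, 2 • c = 0 → c = 0 := by
  -- transport along `zywinaCurve_eq`
  have transfer : ∀ {W₁ W₂ : WeierstrassCurve ℚ} (_ : W₁ = W₂),
      (∀ c ∈ W₂.sha, 2 • c = 0 → c = 0) → ∀ c ∈ W₁.sha, 2 • c = 0 → c = 0 := by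
    intro W₁ W₂ h h₂
    subst h
    exact h₂
  haveI := isElliptic_mk_of_ne_zero (F := ℚ) h.params.hab
  exact transfer (zywinaCurve_eq m n) h.params.forall_mem_sha_two_smul_eq_zero

/-- `Ш(E_{m,n}/ℚ)[2] = 0` as a subgroup of `H¹(ℚ, E_{m,n})`: `Ш(E_{m,n}/ℚ) ⊓ H¹(ℚ, E_{m,n})[2] = ⊥`.
[cite: Zywina2025, §1 (remark after Thm 1.2)] -/
theorem sha_inf_torsionBy_two_zywinaCurve {m n : ℕ} (h : ZywinaAdmissible m n) :
    (zywinaCurve m n).sha ⊓ AddSubgroup.torsionBy (zywinaCurve m n).galH1 2 = ⊥ := by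
  refine eq_bot_iff.mpr fun c hc ↦ ?_
  rw [AddSubgroup.mem_inf] at hc
  exact AddSubgroup.mem_bot.mpr (forall_mem_sha_two_smul_eq_zero_zywinaCurve h _ hc.1
    ((AddSubgroup.torsionBy.nsmul_iff (n := 2)).mp hc.2))

/-- **`#Sel^(2)(E_{m,n}/ℚ) = 2³`** (Zywina, Lemma 3.5: `E(ℚ)/2E(ℚ) ≅ (ℤ/2ℤ)³`, together with
`Ш(E/ℚ)[2] = 0` of §1 in the exact sequence `0 → E(ℚ)/2E(ℚ) → Sel^(2)(E/ℚ) → Ш(E/ℚ)[2] → 0`): from the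
tree's exact descent count `#Sel^(n) = n^{rank} · #E(ℚ)[n] · #Ш[n]` (`natCard_selmerGroup_eq`, Silverman
X.4.2) with `rank = 2` (Thm 1.2), `#E(ℚ)[2] = 2` (Lemma 3.4) and `Ш[2] = 0`.
[cite: Zywina2025, Lemma 3.5 and §1 (remark after Thm 1.2)] [cite: SilvermanAEC2009, Thm X.4.2] -/
theorem natCard_selmerGroup_two_zywinaCurve {m n : ℕ} (h : ZywinaAdmissible m n) :
    Nat.card ((zywinaCurve m n).selmerGroup ((2 : ℕ) : ℤ)) = 2 ^ 3 := by
  haveI := isElliptic_zywinaCurve h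
  have hsha : (zywinaCurve m n).sha ⊓ AddSubgroup.torsionBy (zywinaCurve m n).galH1 ((2 : ℕ) : ℤ) = ⊥ :=
    sha_inf_torsionBy_two_zywinaCurve h
  rw [(zywinaCurve m n).natCard_selmerGroup_eq two_ne_zero, mordellWeilRank_zywinaCurve h, hsha,
    AddSubgroup.card_bot]
  -- `#E(ℚ)[2] = 2`; the general count carries the classical `DecidableEq ℚ` inside the group law of
  -- `E(ℚ)`, so the tree's value is transported along the (subsingleton) instance by `convert`
  have hTor : Nat.card (AddSubgroup.torsionBy (zywinaCurve m n).toAffine.Point ((2 : ℕ) : ℤ)) = 2 :=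
    natCard_torsionBy_two_zywinaCurve h
  have key : ∀ T : ℕ, T = 2 → 2 ^ 2 * T * 1 = 2 ^ 3 := by
    intro T hT
    subst hT
    norm_num
  refine key _ ?_
  convert hTor

/-- **`Ш(E_{m,n}/ℚ)[2^∞] = 0`**: the `2`-primary part of `Ш(E_{m,n}/ℚ)` is trivial (no `2`-torsion ⇒
no `2`-power torsion). [cite: Zywina2025, §1 (remark after Thm 1.2)] -/
theorem primaryComponent_sha_two_zywinaCurve {m n : ℕ} (h : ZywinaAdmissible m n) :
    AddCommGroup.primaryComponent (zywinaCurve m n).sha 2 = ⊥ :=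
  (zywinaCurve m n).primaryComponent_sha_eq_bot_of_forall (forall_mem_sha_two_smul_eq_zero_zywinaCurve h)

/-- `corank_{ℤ₂} Ш(E_{m,n}/ℚ)[2^∞] = 0` (the tree's `shaCorank`; `Ш[2^∞] = 0`).
[cite: Zywina2025, §1 (remark after Thm 1.2)] -/
theorem shaCorank_two_zywinaCurve {m n : ℕ} (h : ZywinaAdmissible m n) :
    (zywinaCurve m n).shaCorank 2 = 0 :=
  (zywinaCurve m n).shaCorank_eq_zero_of_forall 2 (forall_mem_sha_two_smul_eq_zero_zywinaCurve h)

/-- **`corank_{ℤ₂} Sel_{2^∞}(E_{m,n}/ℚ) = 2`** (`= rank E_{m,n}(ℚ)`): Theorem 1.2 (`rank = 2`),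
`Ш(E_{m,n}/ℚ)[2^∞] = 0`, and the corank identity `corank Sel_{p^∞} = rank + corank Ш[p^∞]`
(tree theorem `selmerCorank_eq_mordellWeilRank_add_holds`). [cite: Zywina2025, Thm 1.2 and §1 (remark after Thm 1.2)] -/
theorem selmerCorank_two_zywinaCurve {m n : ℕ} (h : ZywinaAdmissible m n) :
    (zywinaCurve m n).selmerCorank 2 = 2 := by
  haveI := isElliptic_zywinaCurve h
  rw [(zywinaCurve m n).selmerCorank_eq_mordellWeilRank_add_holds 2, mordellWeilRank_zywinaCurve h,
    shaCorank_two_zywinaCurve h]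

/-- **The root number `W(E_{m,n}) = +1` from `2`-parity.** Granted the `2`-parity theorem for
elliptic curves over `ℚ` — `(-1)^{corank_{ℤ₂} Sel_{2^∞}(E/ℚ)} = w(E)` (Monsky 1996; Dokchitser–Dokchitser,
Ann. of Math. 172 (2010), Thm. 1.4 with Cor. 4.20; the tree's named fact `p_parity W 2`) — Zywina's curves
have global root number `+1`, since `corank Sel_{2^∞}(E_{m,n}/ℚ) = 2` (`selmerCorank_two_zywinaCurve`).
This is the value asserted in Zywina's §1.1 ("`m ≡ 11 (mod 24)` … implies `W₂ = W₃ = 1` and hence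
`W(E) = 1`", via local root numbers, without printed proof); here it is derived from the descent.
[cite: Zywina2025, §1.1] [cite: DokchitserDokchitserAnnals2010, Thm. 1.4] -/
theorem rootNumber_zywinaCurve (hpar : ∀ (W : WeierstrassCurve ℚ) [W.IsElliptic], p_parity W 2)
    {m n : ℕ} (h : ZywinaAdmissible m n) : (zywinaCurve m n).rootNumber = 1 := by
  haveI := isElliptic_zywinaCurve h
  have key : (-1 : ℤ) ^ (zywinaCurve m n).selmerCorank 2 = (zywinaCurve m n).rootNumber :=
    hpar (zywinaCurve m n)
  rw [selmerCorank_two_zywinaCurve h] at key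
  rw [← key]
  norm_num

/-- **`W(E_{m,n}) = +1` on the whole family**, in the shape of the cell's typed-chain hypothesis
(`∀ m n, ZywinaAdmissible m n → W(E_{m,n}) = 1`), from the `p`-parity fact in the form the tree's users
carry it (`∀ W p, p_parity W p`; only `p = 2` is used). [cite: Zywina2025, §1.1]
[cite: DokchitserDokchitserAnnals2010, Thm. 1.4] -/
theorem rootNumber_zywinaCurve_of_p_parity
    (hpar : ∀ (W : WeierstrassCurve ℚ) [W.IsElliptic] (p : ℕ) [Fact p.Prime], p_parity W p) :
    ∀ m n : ℕ, ZywinaAdmissible m n → (zywinaCurve m n).rootNumber = 1 :=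
  fun _ _ h ↦ rootNumber_zywinaCurve (fun W _ ↦ hpar W 2) h

end Literature.NumberTheory.EllipticCurves.Zywina2025

end
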